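import Literature.Computability.AlgebraicComplexity.Polarization
import Literature.Computability.AlgebraicComplexity.PlethysmLifting
import Literature.NumberTheory.DiophantineGeometry.SchurWeylPlethysmHwMultiplicityProofs
import Mathlib.LinearAlgebra.FiniteDimensional.Lemmas
import HarnessLib

/-!
# Plethysm stability: the supports of highest-weight vectors of `Sym^d Sym^n V`
(Bürgisser–Ikenmeyer–Panova 2019, §4(a) Prop. 4.5 with Lemma 4.3, and the mechanism of
Props. 5.6(2), 5.8(2))

Topic `Literature/Computability/AlgebraicComplexity`, conventions of `OrbitCoordinateRing.lean`
(`coordRep σ k n`: `GL(k^σ)` acting on `k[Sym^n (k^σ)] = MvPolynomial (DegIdx σ n) k` by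
`(g · F)(q) = F(g⁻¹ q)`; highest weights for the upper triangular Borel, `GLHighestWeight.lean`) and
of the word model `wordRep k M D` of `(k^M)^{⊗D}` (`TensorWordModel.lean`).

Source: P. Bürgisser, C. Ikenmeyer, G. Panova, *No occurrence obstructions in geometric complexity
theory*, J. Amer. Math. Soc. 32 (2019) 163–193 = arXiv:1604.06431v3 (numbering of v3), §3(b), §4(a),
§5. The two "surjectivity" statements of BIP §5 that the companion file
`Literature/Computability/Complexity/OccurrenceObstructionsBIP.lean` keeps as named facts,

* Prop. 5.6(2): "Suppose that `λ ⊢ nd` satisfies `λ₂ ≤ m` and `λ₂ + |λ̄| ≤ md`. Then every highest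
  weight vector of weight `λ` in `Sym^d Sym^n V` is obtained by lifting a highest weight vector in
  `Sym^d Sym^m V` of weight `μ`, where `μ ⊢ md` such that `μ̄ = λ̄`",
* Prop. 5.8(2): "Suppose that `f` is a highest weight vector in `Sym^d Sym^m V` of weight `μ ⊢ dm`
  and assume that `μ₂ + |μ̄| ≤ k ≤ d` for some `k`. Then `μ = ν♯dm` for some `ν ⊢ mk` and
  `f = (e_1^m)^{d-k} · g` for some `g ∈ HWV_ν(Sym^k Sym^m V)`",

rest in print on Prop. 4.5 ("The vector space `HWV_λ(Sym^d Sym^n V)` is spanned by the highest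
weight vectors `v_T`, where `T` ranges over all … tableaux of shape `λ` with content `d × n`, such
that no letter appears more than once in a column of `T`"), itself a consequence of Prop. 3.3
(Schur–Weyl: `HWV_λ(⊗^D V)` is spanned by the `S_D`-orbit of `v_λ`) and Lemma 4.3(1). This file
proves the representation-theoretic heart of both propositions — the SUPPORT statements for
highest-weight vectors — and the algebra needed to read them in `k[Sym^n]_d`; the discharges
`bip2019_prop_5_6_2_holds`, `bip2019_prop_5_8_2_holds` (partition bookkeeping in the `MatIdx N`
conventions of the BIP file) are in `Literature/Computability/Complexity/PlethysmStabilityBIP.lean`.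

## Contents and proof architecture (BIP §4(a), §5, in the dual picture)

1. **Prop. 3.3 in basis form** (`highestWeightSpace_wordRep_eq_span_polytabloid`): the tree's
   Schur–Weyl multiplicity theorem (`SchurWeylPlethysmHwMultiplicityProofs`: the polytabloids `e_T`
   of the standard tableaux are linearly independent highest-weight vectors, and
   `dim HW_λ ≤ #SYT(λ)`) says that `HW_λ` of the word model is SPANNED by the `e_T` — each a
   position permutation of BIP's `v_λ` (3.3).
2. **The wreath product and Lemma 4.3(1)** (`blockPerms`, `blockSymmetrizer`,
   `StdFilling.blockSymmetrizer_polytabloid_eq_zero`): positions `[D·m]` come in `D` blocks of `m`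
   (BIP §4); the symmetriser `Σ = ∑_{τ ∈ S_D ≀ S_m} τ` ((4.1), unnormalised) kills `e_T` as soon as a
   column of `T` meets a block twice (the transposition is in `C_T ∩ S_D ≀ S_m` and acts by `-1`,
   (3.5)).
3. **Supports** (`le_blockZeros_add_rowLen_of_mem_highestWeightSpace`,
   `le_zeroBlocks_add_of_mem_highestWeightSpace`): a wreath-invariant highest-weight vector `x` of
   weight `λ` satisfies `|S_D ≀ S_m| x = Σ x = ∑_T a_T Σ e_T`; in the support of `Σ e_T` (`T` good)
   every block has `≥ m - λ₂` letters `0` (entries in singleton columns carry the first-row letter,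
   and a block meets each of the `λ₂` non-singleton columns at most once) — Prop. 5.6; and in the
   support of any `e_T` at least `D - (λ₂ + |λ̄|)` blocks read `0^m` — Prop. 5.8.
4. **Transport, a dictionary** (`wordOfForm`, `wordOfForm_coordSubst`,
   `wordOfForm_mem_highestWeightSpace`, `wordOfForm_comp_of_mem_blockPerms`, and backwards
   `mem_highestWeightSpace_of_wordOfForm_mem`, `formOfWord`, `wordOfForm_formOfWord`,
   `formOfWord_wordOfForm`, `formOfWord_mem_highestWeightSpace`): the full polarisation `Φ` of
   `Polarization.lean` read on flat words through an order-REVERSING enumeration `ρ : Fin M ≃ σ`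
   of the variables is a bijection between the forms of degree `d` on `Sym^n (k^σ)` and the
   `S_d ≀ S_n`-invariant functions on words of length `dn` (BIP (4.1):
   `Sym^d Sym^n V = (⊗^{dn} V)^{S_d ≀ S_n}`), under which `b = ρ (g⁻¹)ᵀ ρ⁻¹ ∈ GL(k^σ)` acting by
   `coordRep` corresponds to `g ∈ GL_M` acting by `wordRep`; so highest-weight vectors of weight
   `χ` (`coordRep`, a dual convention) correspond to wreath-invariant highest-weight vectors of the
   word model of weight `i ↦ -χ(ρ i)` (for `χ = λ^*` this is `λ`), `ρ 0` being the greatest variable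
   (BIP's `e_1`). The backward direction is the entry point for turning explicit tableau vectors
   `v_T` (BIP §4, §7) into occurrence statements.
5. **Back to polynomials** (`le_apply_of_mem_support_of_polarize`,
   `le_apply_single_of_mem_support_of_polarize`, `eq_X_pow_mul_of_le_apply`, `innerLower`,
   `innerLift_innerLower_of_forall_le`, `innerLift_injective`, `mem_highestWeightSpace_of_mul`,
   `mem_highestWeightSpace_of_innerLift_mem`): blockwise letter counts of the support of `Φ(h)`
   are exponent conditions on the monomials of `h`; a form in the coordinates `X_e` with
   `e(top) ≥ n - m` is an inner lifting `innerLift f` (dual `κ`, `PlethysmLifting.lean`; Lemma 5.1,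
   Lemma 5.3 and its converse by injectivity, §5(b)), and a form all of whose monomials contain
   `X_{x_top^n}^{d-k}` is `X_{x_top^n}^{d-k} · g` with `g` again a highest-weight vector
   ((5.8) is multiplication by `e_1^m`).
6. **Main theorems** (`le_apply_add_of_mem_highestWeightSpace_coordRep`,
   `le_apply_single_add_of_mem_highestWeightSpace_coordRep`): the support forms of Props. 5.6(2)
   and 5.8(2) for `k[Sym^n (k^σ)]_d`, any field of characteristic zero, any finite linearly
   ordered `σ`.
7. **Tableau vectors and the contraction rule** (`StdFilling.polytabloid_apply_of_forall_eq`,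
   `tabVector`, `tabVector_apply`, `tabVector_apply_ne_zero`): BIP's `v_T` (Def. 4.2) in the word
   model, Thm. 4.7 (the value of `e_{T₀}` at a word is the column sign (4.2)–(4.3), and `v_T(s)` is
   the sum over the wreath product), and the positivity criterion behind Claim 7.1 / Props. 7.2,
   7.3 (if every respecting bijection with nonzero value keeps rows, `v_T(row tensor) ≠ 0`) — the
   generic half of a future discharge of Prop. 7.3 (`bip2019_prop_7_3`,
   `OccurrenceObstructionsHooks.lean`), the specific tableaux of §7 being the other half.

`CharZero k` is used throughout (polytabloid spanning, division by fibre sizes in `arrOf`, `2 ≠ 0`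
in Lemma 4.3). Nothing is specific to `k = ℂ`.

## References

* P. Bürgisser, C. Ikenmeyer, G. Panova, *No occurrence obstructions in geometric complexity
  theory*, J. AMS 32 (2019) = arXiv:1604.06431v3: §3(b) (3.3)–(3.6), Prop. 3.3; §4, (4.1),
  Def. 4.1, 4.2, Lemma 4.3, Def. 4.4, Prop. 4.5; §5(a) Lemma 5.1, 5.2; §5(b) (5.3), Lemma 5.3,
  Thm. 5.4, 5.5, Prop. 5.6; §5(c) (5.8), Lemma 5.7, Prop. 5.8. [key `BurgisserIkenmeyerPanovaJAMS2019`]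
* W. Fulton, *Young Tableaux*, LMS Student Texts 35 (1997), §7.2 (Lemma 2), §8.1–8.3
  (the basis `e_T`, polytabloids as highest-weight vectors). [key `FultonYoungTableaux1997`]
* G. D. James, *The Representation Theory of the Symmetric Groups*, LNM 682 (1978), 4.3–4.6
  (polytabloids, `κ_t`, sign action of the column stabiliser). [key `JamesLNM682`]

## Mathlib and tree

Mathlib: `finProdFinEquiv`, `Equiv.Perm` (`swap`, `sign_swap`, `sign_mul`), `Subgroup`,
`Submodule.span` (`mem_span_range_iff_exists_fun`, `LinearIndependent.span_eq_top_of_card_eq_finrank'`),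
`YoungDiagram` (`rowLen`, `mem_iff_lt_rowLen`, `up_left_mem`, `rowLen_anti`), `Nat.Partition`,
`Matrix.reindex`/`submatrix` (`submatrix_mul_equiv`, `submatrix_one_equiv`), `MvPolynomial`
(`IsHomogeneous.aeval`, `support_sum_monomial_coeff`, `monomial_eq`, `Nat.descFactorial`).
Tree: `wordRep`, `wordPerm`, `highestWeightSpace`, `ydWeight`, `StdFilling` (`polytabloid`,
`colStab`, `colAntisym`, `rowWord`, `polytabloid_mem`, `linearIndependent_polytabloid`,
`exists_of_polytabloid_apply_ne_zero`, `finrank_highestWeightSpace_le_card_stdFilling`,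
`fst_lt_of_mem_youngDiagram`, `rowLen_youngDiagram`), `polarize`/`polarize_coordSubst`/`arrOf`/
`wordExp` (`Polarization`, `Hyperdeterminant`), `innerLift`/`coordSubst_innerLift`/`iterPderiv_monomial`
(`PlethysmLifting`), `weightChar_add`/`weightChar_single` (`TensorWordModel`),
`inv_apply_diag_of_isUpperTriangular'` (`OrbitClosureWeights`). Mathlib has no plethysm, no
Schur–Weyl duality and no wreath products of symmetric groups acting on tensor powers.
-/

open scoped BigOperators

namespace Literature.Computability.AlgebraicComplexity

/-! ### 1. Highest-weight vectors of `(k^N)^{⊗d}` are spanned by the polytabloids (BIP Prop. 3.3) -/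

section Span

variable {k : Type*} [Field k] [CharZero k] {N d : ℕ} {Y : YoungDiagram}

/-- **BIP Prop. 3.3 in basis form (Schur–Weyl: the highest-weight vectors of weight `λ` in
`⊗^d V` are spanned by the `S_d`-orbit of `v_λ`).** For a Young diagram `Y` with `d` cells and
fewer than `N` rows, the space of highest-weight vectors of weight `λ = (|row_0|, |row_1|, …)`
in the word model of `(k^N)^{⊗d}` is the span of the polytabloids `e_T` of the standard
tableaux `T` of shape `Y` (each `e_T = ∑_{σ ∈ C_T} sgn σ · e_{w_T ∘ σ⁻¹}` is a permutation of
the positions applied to BIP's `v_λ`, (3.3)). Proof: the `e_T` are linearly independent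
highest-weight vectors (`StdFilling.linearIndependent_polytabloid`, `polytabloid_mem`) and
`dim ≤ #SYT(Y)` (`finrank_highestWeightSpace_le_card_stdFilling`), all in the tree
(`SchurWeylPlethysmHwMultiplicityProofs`). BIP: "3.3. Proposition. Let `λ ⊢ D`. Then the vector
space `HWV_λ(⊗^D V)` is spanned by the `S_D`-orbit of `v_λ`." (characteristic zero).
[cite: BurgisserIkenmeyerPanovaJAMS2019, Prop. 3.3] -/
theorem highestWeightSpace_wordRep_eq_span_polytabloid (hN : ∀ x ∈ Y.cells, x.1 < N)
    (hd : Y.cells.card = d) :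
    Literature.NumberTheory.DiophantineGeometry.highestWeightSpace (Literature.NumberTheory.DiophantineGeometry.wordRep k N d) (Literature.NumberTheory.DiophantineGeometry.ydWeight N Y) =
      Submodule.span k (Set.range fun T : Literature.NumberTheory.DiophantineGeometry.StdFilling d Y => T.polytabloid k hN) := by
  classical
  set H := Literature.NumberTheory.DiophantineGeometry.highestWeightSpace (Literature.NumberTheory.DiophantineGeometry.wordRep k N d) (Literature.NumberTheory.DiophantineGeometry.ydWeight N Y) with hH
  let v : Literature.NumberTheory.DiophantineGeometry.StdFilling d Y → H := fun T => ⟨T.polytabloid k hN, T.polytabloid_mem hN hd⟩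
  have hv : LinearIndependent k v :=
    LinearIndependent.of_comp H.subtype (Literature.NumberTheory.DiophantineGeometry.StdFilling.linearIndependent_polytabloid hN hd)
  have hcard : Fintype.card (Literature.NumberTheory.DiophantineGeometry.StdFilling d Y) = Module.finrank k H :=
    le_antisymm hv.fintype_card_le_finrank (by
      rw [← Nat.card_eq_fintype_card]
      exact Literature.NumberTheory.DiophantineGeometry.finrank_highestWeightSpace_le_card_stdFilling d Y hd hN)
  have hspan : Submodule.span k (Set.range v) = ⊤ := hv.span_eq_top_of_card_eq_finrank' hcard
  have h2 := congrArg (Submodule.map H.subtype) hspan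
  rw [Submodule.map_span, Submodule.map_top, Submodule.range_subtype, ← Set.range_comp] at h2
  exact h2.symm

/-- Coordinates in the polytabloid basis: a highest-weight vector of weight `λ` in the word
model is `∑_T a_T e_T` over the standard tableaux. [cite: BurgisserIkenmeyerPanovaJAMS2019, Prop. 3.3] -/
theorem exists_sum_smul_polytabloid_eq (hN : ∀ x ∈ Y.cells, x.1 < N) (hd : Y.cells.card = d)
    {x : Literature.NumberTheory.DiophantineGeometry.Word N d → k}
    (hx : x ∈ Literature.NumberTheory.DiophantineGeometry.highestWeightSpace (Literature.NumberTheory.DiophantineGeometry.wordRep k N d) (Literature.NumberTheory.DiophantineGeometry.ydWeight N Y)) :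
    ∃ a : Literature.NumberTheory.DiophantineGeometry.StdFilling d Y → k, ∑ T, a T • T.polytabloid k hN = x := by
  rw [highestWeightSpace_wordRep_eq_span_polytabloid hN hd,
    Submodule.mem_span_range_iff_exists_fun] at hx
  exact hx

end Span

/-! ### 2. Blocks of positions, the wreath subgroup `S_D ≀ S_m`, and its symmetriser -/

section Wreath

variable {D m : ℕ}

/-- The block of a position: `[D·m] = B_0 ∪ ⋯ ∪ B_{D-1}`, position `q ↦ q / m` (Mathlib's
`finProdFinEquiv`, `q = r·m + p ↔ (r, p)`). BIP §4: "We partition the position set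
`[dn] := {1, …, dn}` into the blocks `B_1, …, B_d`, where `B_u := {(u-1)n + v | 1 ≤ v ≤ n}`."
[cite: BurgisserIkenmeyerPanovaJAMS2019, §4] -/
def blockIdx (D m : ℕ) (q : Fin (D * m)) : Fin D :=
  (finProdFinEquiv.symm q).1

/-- The block of position `(r, p)` is `r`. [folklore] -/
@[simp]
theorem blockIdx_finProdFinEquiv (r : Fin D) (p : Fin m) : blockIdx D m (finProdFinEquiv (r, p)) = r := by
  simp [blockIdx]

/-- A position is determined by its block and its place in the block. [folklore] -/
theorem finProdFinEquiv_blockIdx (q : Fin (D * m)) :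
    finProdFinEquiv (blockIdx D m q, (finProdFinEquiv.symm q).2) = q := by
  rw [blockIdx, Prod.mk.eta]
  exact finProdFinEquiv.apply_symm_apply q

/-- **The wreath product `S_D ≀ S_m ≤ S_{Dm}`**: the permutations of the positions mapping
blocks to blocks (equivalently, preserving the partition into blocks). BIP §4: "The subgroup of
`S_{dn}` of permutations that preserve the partition into blocks is called the wreath product
`S_d ≀ S_n`. It is generated by the permutations leaving the blocks invariant, and the
permutations … which simultaneously permute the blocks." [cite: BurgisserIkenmeyerPanovaJAMS2019, §4] -/
def blockPerms (D m : ℕ) : Subgroup (Equiv.Perm (Fin (D * m))) where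
  carrier := {τ | ∀ q q', blockIdx D m (τ q) = blockIdx D m (τ q') ↔ blockIdx D m q = blockIdx D m q'}
  mul_mem' {τ τ'} hτ hτ' q q' := by
    rw [Equiv.Perm.mul_apply, Equiv.Perm.mul_apply, hτ, hτ']
  one_mem' q q' := by simp
  inv_mem' {τ} hτ q q' := by
    have h := hτ (τ⁻¹ q) (τ⁻¹ q')
    simp only [Equiv.Perm.coe_inv, Equiv.apply_symm_apply] at h
    exact h.symm

/-- Membership in the wreath product (unfolding lemma). [folklore] -/
theorem mem_blockPerms {τ : Equiv.Perm (Fin (D * m))} :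
    τ ∈ blockPerms D m ↔ ∀ q q', blockIdx D m (τ q) = blockIdx D m (τ q') ↔ blockIdx D m q = blockIdx D m q' :=
  Iff.rfl

/-- A transposition of two positions of one block lies in the wreath product (it leaves every
block invariant); used in the proof of Lemma 4.3(1). [cite: BurgisserIkenmeyerPanovaJAMS2019, Lemma 4.3 (proof)] -/
theorem swap_mem_blockPerms {p q : Fin (D * m)} (h : blockIdx D m p = blockIdx D m q) :
    Equiv.swap p q ∈ blockPerms D m := by
  classical
  have key : ∀ x, blockIdx D m (Equiv.swap p q x) = blockIdx D m x := by
    intro x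
    rcases eq_or_ne x p with rfl | hxp
    · rw [Equiv.swap_apply_left]; exact h.symm
    rcases eq_or_ne x q with rfl | hxq
    · rw [Equiv.swap_apply_right]; exact h
    · rw [Equiv.swap_apply_of_ne_of_ne hxp hxq]
  intro x y
  rw [key, key]

/-- The wreath product as a `Finset` (for summation). [folklore] -/
noncomputable def blockPermsFinset (D m : ℕ) : Finset (Equiv.Perm (Fin (D * m))) := by
  classical exact Finset.univ.filter (· ∈ blockPerms D m)

/-- Membership in `blockPermsFinset` (unfolding lemma). [folklore] -/
theorem mem_blockPermsFinset {τ : Equiv.Perm (Fin (D * m))} :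
    τ ∈ blockPermsFinset D m ↔ τ ∈ blockPerms D m := by
  classical
  simp [blockPermsFinset]

/-- The identity is a block permutation. [folklore] -/
theorem one_mem_blockPermsFinset : (1 : Equiv.Perm (Fin (D * m))) ∈ blockPermsFinset D m :=
  mem_blockPermsFinset.mpr (blockPerms D m).one_mem

/-- The wreath product is nonempty. [folklore] -/
theorem card_blockPermsFinset_pos : 0 < (blockPermsFinset D m).card :=
  Finset.card_pos.mpr ⟨1, one_mem_blockPermsFinset⟩

variable (k : Type*) [CommRing k] {N : ℕ}

/-- **The (unnormalised) wreath symmetriser `Σ_{D,m} = ∑_{σ ∈ S_D ≀ S_m} σ`** acting on the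
word model of `V^{⊗ Dm}` by permutation of the positions (`wordPerm`). BIP (4.1):
"`Σ_{d,n} := (1/(d! n!^d)) ∑_{σ ∈ S_d ≀ S_n} σ` … We obtain the plethysm `Sym^d Sym^n V` as the
space of `S_d ≀ S_n`-invariants in `⊗^{dn} V`. This space is the image of the projection
`w ↦ Σ_{d,n} w`." The normalising factor is dropped (it is invertible in characteristic zero and
plays no role below). [cite: BurgisserIkenmeyerPanovaJAMS2019, §4 (4.1)] -/
noncomputable def blockSymmetrizer (D m : ℕ) : (Literature.NumberTheory.DiophantineGeometry.Word N (D * m) → k) →ₗ[k] (Literature.NumberTheory.DiophantineGeometry.Word N (D * m) → k) :=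
  ∑ τ ∈ blockPermsFinset D m, Literature.NumberTheory.DiophantineGeometry.wordPerm k τ

/-- `(Σ x)(w) = ∑_{τ} x(w ∘ τ)` (unfolding lemma). [cite: BurgisserIkenmeyerPanovaJAMS2019, §4 (4.1)] -/
theorem blockSymmetrizer_apply (x : Literature.NumberTheory.DiophantineGeometry.Word N (D * m) → k) (w : Literature.NumberTheory.DiophantineGeometry.Word N (D * m)) :
    blockSymmetrizer k D m x w = ∑ τ ∈ blockPermsFinset D m, x (w ∘ ⇑τ) := by
  simp [blockSymmetrizer, LinearMap.sum_apply, Finset.sum_apply]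

/-- `Σ ∘ τ = Σ` for `τ` in the wreath product (right invariance of the sum over a group).
[cite: BurgisserIkenmeyerPanovaJAMS2019, §4 (4.1)] -/
theorem blockSymmetrizer_wordPerm {τ : Equiv.Perm (Fin (D * m))} (hτ : τ ∈ blockPerms D m)
    (x : Literature.NumberTheory.DiophantineGeometry.Word N (D * m) → k) :
    blockSymmetrizer k D m (Literature.NumberTheory.DiophantineGeometry.wordPerm k τ x) = blockSymmetrizer k D m x := by
  rw [blockSymmetrizer, LinearMap.sum_apply, LinearMap.sum_apply]
  simp_rw [← LinearMap.comp_apply (g := Literature.NumberTheory.DiophantineGeometry.wordPerm k τ), ← Literature.NumberTheory.DiophantineGeometry.wordPerm_mul]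
  refine Finset.sum_bij' (fun τ' _ => τ' * τ) (fun τ' _ => τ' * τ⁻¹) ?_ ?_ ?_ ?_ ?_
  · intro τ' hτ'
    exact mem_blockPermsFinset.mpr ((blockPerms D m).mul_mem (mem_blockPermsFinset.mp hτ') hτ)
  · intro τ' hτ'
    exact mem_blockPermsFinset.mpr
      ((blockPerms D m).mul_mem (mem_blockPermsFinset.mp hτ') ((blockPerms D m).inv_mem hτ))
  · intro τ' _; simp
  · intro τ' _; simp
  · intro τ' _; rfl

/-- On wreath-invariant vectors the symmetriser is multiplication by the order of the wreath
product. [cite: BurgisserIkenmeyerPanovaJAMS2019, §4 (4.1)] -/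
theorem blockSymmetrizer_apply_of_forall_wordPerm_eq {x : Literature.NumberTheory.DiophantineGeometry.Word N (D * m) → k}
    (hx : ∀ τ ∈ blockPerms D m, Literature.NumberTheory.DiophantineGeometry.wordPerm k τ x = x) :
    blockSymmetrizer k D m x = (blockPermsFinset D m).card • x := by
  rw [blockSymmetrizer, LinearMap.sum_apply, Finset.card_eq_sum_ones, Finset.sum_smul]
  refine Finset.sum_congr rfl fun τ hτ => ?_
  rw [hx τ (mem_blockPermsFinset.mp hτ), one_smul]

end Wreath

/-! ### 3. Polytabloids under the column stabiliser; BIP Lemma 4.3(1) -/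

section Lemma43

variable {k : Type*} [Field k] {N d : ℕ} {Y : YoungDiagram}

/-- **The column stabiliser acts on a polytabloid by the sign** (BIP (3.5): "`τ π v_λ = -π v_λ`
if `i` and `j` are in the same column in `π T_λ^std`", for the transposition `τ = (i j)`; here
for all of `C_T`): `τ · e_T = sgn(τ) e_T` for `τ ∈ C_T`, as `κ_T τ⁻¹`-reindexing of
`e_T = κ_T e_{w_T}`. Fulton, *Young Tableaux*, §7.2 Lemma 2 / James, LNM 682, 4.3.
[cite: BurgisserIkenmeyerPanovaJAMS2019, §3(b) (3.5)] -/
theorem _root_.Literature.NumberTheory.DiophantineGeometry.StdFilling.wordPerm_polytabloid_of_mem_colStab (hN : ∀ x ∈ Y.cells, x.1 < N)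
    (T : Literature.NumberTheory.DiophantineGeometry.StdFilling d Y) {τ : Equiv.Perm (Fin d)} (hτ : τ ∈ T.colStab) :
    Literature.NumberTheory.DiophantineGeometry.wordPerm k τ (T.polytabloid k hN) = ((Equiv.Perm.sign τ : ℤ) : k) • T.polytabloid k hN := by
  rw [Literature.NumberTheory.DiophantineGeometry.StdFilling.polytabloid, Literature.NumberTheory.DiophantineGeometry.StdFilling.colAntisym_apply, map_sum, Finset.smul_sum]
  simp_rw [map_smul, ← LinearMap.comp_apply, ← Literature.NumberTheory.DiophantineGeometry.wordPerm_mul]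
  -- reindex `σ ↦ τ * σ`
  refine Finset.sum_bij' (fun σ _ => τ * σ) (fun σ _ => τ⁻¹ * σ) ?_ ?_ ?_ ?_ ?_
  · intro σ hσ; exact Literature.NumberTheory.DiophantineGeometry.StdFilling.mul_mem_colStab hτ hσ
  · intro σ hσ; exact Literature.NumberTheory.DiophantineGeometry.StdFilling.mul_mem_colStab (Literature.NumberTheory.DiophantineGeometry.StdFilling.inv_mem_colStab hτ) hσ
  · intro σ _; simp
  · intro σ _; simp
  · intro σ _
    rw [smul_smul, Equiv.Perm.sign_mul, Units.val_mul, Int.cast_mul, ← mul_assoc,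
      ← Int.cast_mul, ← Units.val_mul, Int.units_mul_self, Units.val_one, Int.cast_one, one_mul]

variable {D m : ℕ}

/-- **BIP Lemma 4.3(1)** ("Let `T` be a tableau of shape `λ` with content `d × n`. If the
same letter appears in a column of `T` more than once, then `v_T = 0`"), in the word model: if
two distinct entries `p ≠ q` of one column of the standard tableau `T` lie in the same block,
then the wreath symmetrisation of the polytabloid `e_T` vanishes — the transposition `(p q)`
lies in `S_D ≀ S_m` and in `C_T`, so `Σ e_T = Σ (p q) e_T = -Σ e_T` (characteristic zero). BIP's
proof verbatim: "the transposition `τ := (i j)` is an element of `S_d ≀ S_n`. Using (3.5), we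
see that symmetrizing `π v_λ` over the 2-element subgroup `{id, τ}` maps `π v_λ` to zero."
[cite: BurgisserIkenmeyerPanovaJAMS2019, Lemma 4.3 (1)] -/
theorem _root_.Literature.NumberTheory.DiophantineGeometry.StdFilling.blockSymmetrizer_polytabloid_eq_zero [CharZero k] {Y : YoungDiagram}
    (hN : ∀ x ∈ Y.cells, x.1 < N) (T : Literature.NumberTheory.DiophantineGeometry.StdFilling (D * m) Y) {p q : Fin (D * m)} (hpq : p ≠ q)
    (hcol : (T.1 p).2 = (T.1 q).2) (hblk : blockIdx D m p = blockIdx D m q) :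
    blockSymmetrizer k D m (T.polytabloid k hN) = 0 := by
  set S := blockSymmetrizer k D m (T.polytabloid k hN) with hS
  have hτ : Equiv.swap p q ∈ blockPerms D m := swap_mem_blockPerms hblk
  have hneg : S = -S := by
    conv_lhs => rw [hS, ← blockSymmetrizer_wordPerm k hτ,
      T.wordPerm_polytabloid_of_mem_colStab hN (Literature.NumberTheory.DiophantineGeometry.StdFilling.swap_mem_colStab hcol),
      Equiv.Perm.sign_swap hpq, map_smul]
    simp [hS]
  have h2 : (2 : k) • S = 0 := by
    rw [two_smul]
    nth_rewrite 2 [hneg]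
    rw [add_neg_cancel]
  exact (smul_eq_zero.1 h2).resolve_left two_ne_zero

end Lemma43

/-! ### 4. Supports: zeros forced in the blocks -/

section Support

variable {k : Type*} [Field k] {N d : ℕ} {Y : YoungDiagram}

/-- **Singleton columns carry the first-row letter.** In a word `w_T ∘ σ` (`σ ∈ C_T`) of the
support of `e_T`, an entry `q` lying in a singleton column of `T` (a column `≥ λ₂ = |row 1|`)
carries the letter `0`: the cell of `σ q` is in the same column, which has no cell in row `1`.
(BIP §4(a): "By a singleton column we understand a column of length one"; in `v_λ` (3.3) a
singleton column contributes the factor `v_{1×1} = e_1`.) [cite: BurgisserIkenmeyerPanovaJAMS2019, §4(a)] -/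
theorem _root_.Literature.NumberTheory.DiophantineGeometry.StdFilling.fst_apply_eq_zero_of_rowLen_one_le (T : Literature.NumberTheory.DiophantineGeometry.StdFilling d Y) {σ : Equiv.Perm (Fin d)}
    (hσ : σ ∈ T.colStab) {q : Fin d} (hq : Y.rowLen 1 ≤ (T.1 q).2) : (T.1 (σ q)).1 = 0 := by
  by_contra h
  have h1 : 1 ≤ (T.1 (σ q)).1 := Nat.one_le_iff_ne_zero.mpr h
  have hmem : T.1 (σ q) ∈ Y := T.mem (σ q)
  have hcolq : (T.1 (σ q)).2 = (T.1 q).2 := Literature.NumberTheory.DiophantineGeometry.StdFilling.mem_colStab.1 hσ q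
  have hup : ((1 : ℕ), (T.1 q).2) ∈ Y := by
    have := Y.up_left_mem h1 (le_refl (T.1 (σ q)).2) (by rw [Prod.mk.eta]; exact hmem)
    rwa [hcolq] at this
  rw [YoungDiagram.mem_iff_lt_rowLen] at hup
  exact absurd hup (not_lt.mpr hq)

variable [NeZero N]

/-- The number of positions of block `r` of a word carrying the letter `0` (the first-row
letter `e_1`). [cite: BurgisserIkenmeyerPanovaJAMS2019, Prop. 5.6 (proof)] -/
def blockZeros {D m : ℕ} (w : Literature.NumberTheory.DiophantineGeometry.Word N (D * m)) (r : Fin D) : ℕ :=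
  (Finset.univ.filter fun p : Fin m => w (finProdFinEquiv (r, p)) = 0).card

/-- The number of blocks of a word all of whose positions carry the letter `0` (blocks reading
`e_1^m`). [cite: BurgisserIkenmeyerPanovaJAMS2019, Prop. 5.8 (proof)] -/
def zeroBlocks {D m : ℕ} (w : Literature.NumberTheory.DiophantineGeometry.Word N (D * m)) : ℕ :=
  (Finset.univ.filter fun r : Fin D => ∀ p : Fin m, w (finProdFinEquiv (r, p)) = 0).card

variable {D m : ℕ}

/-- **Support of `Σ e_T` for a good tableau** (the counting step of BIP's proof of Prop. 5.6(1):
"each of the `d` letters appears at least `n - μ₂ ≥ n - m` times in singleton columns"). If no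
column of the standard tableau `T` contains two entries of one block, `τ` is a block permutation
and `e_T(w ∘ τ) ≠ 0`, then every block of `w` has at most `λ₂ = |row 1|` letters different from
`0`: the nonzero positions of a block map injectively (goodness) to the non-singleton columns.
[cite: BurgisserIkenmeyerPanovaJAMS2019, Prop. 5.6 (1) (proof)] -/
theorem _root_.Literature.NumberTheory.DiophantineGeometry.StdFilling.le_blockZeros_add_rowLen_of_polytabloid_comp_ne_zero
    (hN : ∀ x ∈ Y.cells, x.1 < N) (T : Literature.NumberTheory.DiophantineGeometry.StdFilling (D * m) Y)
    (hgood : ∀ p q, p ≠ q → (T.1 p).2 = (T.1 q).2 → blockIdx D m p ≠ blockIdx D m q)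
    {τ : Equiv.Perm (Fin (D * m))} (hτ : τ ∈ blockPerms D m) {w : Literature.NumberTheory.DiophantineGeometry.Word N (D * m)}
    (hw : T.polytabloid k hN (w ∘ ⇑τ) ≠ 0) (r : Fin D) :
    m ≤ blockZeros w r + Y.rowLen 1 := by
  classical
  obtain ⟨σ, hσ, hwσ⟩ := T.exists_of_polytabloid_apply_ne_zero hN hw
  -- `w = rowWord ∘ σ ∘ τ⁻¹`
  have hwq : ∀ q, w q = T.rowWord hN (σ (τ⁻¹ q)) := fun q => by
    have := congrFun hwσ (τ⁻¹ q)
    simpa using this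
  -- the nonzero positions of block `r` inject into the non-singleton columns
  set bad := Finset.univ.filter fun p : Fin m => w (finProdFinEquiv (r, p)) ≠ 0 with hbad
  have hinj : bad.card ≤ Y.rowLen 1 := by
    have : bad.card ≤ (Finset.range (Y.rowLen 1)).card := by
      refine Finset.card_le_card_of_injOn (fun p => (T.1 (τ⁻¹ (finProdFinEquiv (r, p)))).2) ?_ ?_
      · intro p hp
        simp only [hbad, Finset.coe_filter, Finset.mem_univ, true_and, Set.mem_setOf_eq] at hp
        rw [Finset.coe_range, Set.mem_Iio]
        by_contra hle
        apply hp
        rw [hwq, Literature.NumberTheory.DiophantineGeometry.StdFilling.rowWord]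
        exact Fin.ext (T.fst_apply_eq_zero_of_rowLen_one_le hσ (not_lt.mp hle))
      · intro p _ p' _ hpp'
        have hb : blockIdx D m (τ⁻¹ (finProdFinEquiv (r, p))) = blockIdx D m (τ⁻¹ (finProdFinEquiv (r, p'))) := by
          rw [(mem_blockPerms.mp ((blockPerms D m).inv_mem hτ))]
          simp
        have heq : τ⁻¹ (finProdFinEquiv (r, p)) = τ⁻¹ (finProdFinEquiv (r, p')) := by
          by_contra hne
          exact hgood _ _ hne hpp' hb
        have := finProdFinEquiv.injective (τ⁻¹.injective heq)
        exact (Prod.mk.inj this).2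
    simpa using this
  have hsplit : blockZeros w r + bad.card = m := by
    rw [blockZeros, hbad, Finset.card_filter_add_card_filter_not]
    simp
  omega

/-- **Support of `e_T`, blockwise** (the counting step of BIP's proof of Prop. 5.8: "`ν₂ + |ν̄|`
is the number of boxes in `μ` that are not singleton columns. Hence there are at least
`d - (ν₂ + |ν̄|)` many letters appearing in singleton columns of `T''` only"). If `e_T(w) ≠ 0` then
at least `D - #{cells of Y in non-singleton columns}` blocks of `w` carry only the letter `0`: a
block with a nonzero letter contains an entry in a non-singleton column, and distinct blocks give
distinct cells. [cite: BurgisserIkenmeyerPanovaJAMS2019, Prop. 5.8 (1) (proof)] -/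
theorem _root_.Literature.NumberTheory.DiophantineGeometry.StdFilling.le_zeroBlocks_add_card_of_polytabloid_ne_zero
    (hN : ∀ x ∈ Y.cells, x.1 < N) (T : Literature.NumberTheory.DiophantineGeometry.StdFilling (D * m) Y) {w : Literature.NumberTheory.DiophantineGeometry.Word N (D * m)}
    (hw : T.polytabloid k hN w ≠ 0) :
    D ≤ zeroBlocks w + (Y.cells.filter fun c => c.2 < Y.rowLen 1).card := by
  classical
  obtain ⟨σ, hσ, hwσ⟩ := T.exists_of_polytabloid_apply_ne_zero hN hw
  set bad := Finset.univ.filter fun r : Fin D => ¬ ∀ p : Fin m, w (finProdFinEquiv (r, p)) = 0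
    with hbad
  -- choose a nonzero position in each bad block
  have hch : ∀ r ∈ bad, ∃ p : Fin m, w (finProdFinEquiv (r, p)) ≠ 0 := fun r hr => by
    simp only [hbad, Finset.mem_filter, Finset.mem_univ, true_and, not_forall] at hr
    exact hr
  have hinj : bad.card ≤ (Y.cells.filter fun c => c.2 < Y.rowLen 1).card := by
    refine Finset.card_le_card_of_injOn
      (fun r => if h : r ∈ bad then T.1 (finProdFinEquiv (r, (hch r h).choose)) else (0, 0)) ?_ ?_
    · intro r hr
      have hr' : r ∈ bad := hr
      simp only [dif_pos hr', Finset.coe_filter, Set.mem_setOf_eq, YoungDiagram.mem_cells]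
      refine ⟨T.mem _, ?_⟩
      by_contra hle
      apply (hch r hr').choose_spec
      rw [congrFun hwσ (finProdFinEquiv (r, (hch r hr').choose)), Function.comp_apply, Literature.NumberTheory.DiophantineGeometry.StdFilling.rowWord]
      exact Fin.ext (T.fst_apply_eq_zero_of_rowLen_one_le hσ (not_lt.mp hle))
    · intro r hr r' hr' h
      have hr1 : r ∈ bad := hr
      have hr2 : r' ∈ bad := hr'
      simp only [dif_pos hr1, dif_pos hr2] at h
      have := finProdFinEquiv.injective (T.injective h)
      exact (Prod.mk.inj this).1
  have hsplit : zeroBlocks w + bad.card = D := by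
    rw [zeroBlocks, hbad, Finset.card_filter_add_card_filter_not]
    simp
  omega

/-- **Cells in non-singleton columns.** The cells of a Young diagram in the singleton columns
are `(0, j)`, `λ₂ ≤ j < λ₁`, so `#{cells in columns < λ₂} + λ₁ = |Y| + λ₂` — BIP: "`λ₂ + |λ̄|` is
the number of boxes of `λ` that appear in columns that are not singleton columns" (proof of
Prop. 5.6(2)). Declared in Mathlib's `YoungDiagram` namespace for dot notation (deliberate
extension; the name does not exist in Mathlib). [cite: BurgisserIkenmeyerPanovaJAMS2019, Prop. 5.6 (2) (proof)] -/
theorem _root_.YoungDiagram.card_filter_snd_lt_rowLen_one (Y : YoungDiagram) :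
    (Y.cells.filter fun c => c.2 < Y.rowLen 1).card + Y.rowLen 0 = Y.cells.card + Y.rowLen 1 := by
  classical
  have hcompl : (Y.cells.filter fun c => ¬ c.2 < Y.rowLen 1) =
      (Finset.Ico (Y.rowLen 1) (Y.rowLen 0)).map ⟨fun j => ((0 : ℕ), j), fun a b h => (Prod.mk.inj h).2⟩ := by
    ext ⟨i, j⟩
    simp only [Finset.mem_filter, YoungDiagram.mem_cells, not_lt, Finset.mem_map, Finset.mem_Ico,
      Function.Embedding.coeFn_mk, Prod.mk.injEq]
    constructor
    · rintro ⟨hmem, hj⟩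
      have hi : i = 0 := by
        by_contra hi
        have h1 : 1 ≤ i := Nat.one_le_iff_ne_zero.mpr hi
        have : ((1 : ℕ), j) ∈ Y := Y.up_left_mem h1 (le_refl j) hmem
        rw [YoungDiagram.mem_iff_lt_rowLen] at this
        omega
      subst hi
      refine ⟨j, ⟨hj, ?_⟩, rfl, rfl⟩
      exact YoungDiagram.mem_iff_lt_rowLen.mp hmem
    · rintro ⟨j', ⟨h1, h2⟩, rfl, rfl⟩
      exact ⟨YoungDiagram.mem_iff_lt_rowLen.mpr h2, h1⟩
  have h := Finset.card_filter_add_card_filter_not (s := Y.cells) (fun c => c.2 < Y.rowLen 1)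
  rw [hcompl, Finset.card_map, Nat.card_Ico] at h
  have hanti : Y.rowLen 1 ≤ Y.rowLen 0 := Y.rowLen_anti 0 1 (by norm_num)
  omega

/-- **The mechanism of BIP Prop. 5.6 (inner stability), word-model form.** Let `x` be a
highest-weight vector of weight `λ` (`λ` the shape of `Y`, `|Y| = D·m`, fewer than `N` rows) in
the word model of `V^{⊗ Dm}` which is invariant under the wreath product `S_D ≀ S_m` (i.e. lies
in the plethysm `Sym^D Sym^m V`, (4.1)). Then every word `w` in the support of `x` has, in each of
its `D` blocks, at least `m - λ₂` positions with the letter `0`: writing `|S_D ≀ S_m| · x =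
Σ x = ∑_T a_T Σ e_T` over standard tableaux (Prop. 3.3 / Prop. 4.5), the bad tableaux drop out by
Lemma 4.3(1) and the good ones have the asserted support. This is the content of BIP's proof of
Prop. 5.6: "Let `T'` be a tableau of shape `μ♯dn` with content `d × n` such that no letter
appears more than once in a column. Then each of the `d` letters appears at least
`n - μ₂ ≥ n - m` times in singleton columns." [cite: BurgisserIkenmeyerPanovaJAMS2019, Prop. 5.6 (proof) with Prop. 4.5] -/
theorem le_blockZeros_add_rowLen_of_mem_highestWeightSpace [CharZero k]
    (hN : ∀ x ∈ Y.cells, x.1 < N) (hd : Y.cells.card = D * m) {x : Literature.NumberTheory.DiophantineGeometry.Word N (D * m) → k}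
    (hx : x ∈ Literature.NumberTheory.DiophantineGeometry.highestWeightSpace (Literature.NumberTheory.DiophantineGeometry.wordRep k N (D * m)) (Literature.NumberTheory.DiophantineGeometry.ydWeight N Y))
    (hinv : ∀ τ ∈ blockPerms D m, Literature.NumberTheory.DiophantineGeometry.wordPerm k τ x = x) {w : Literature.NumberTheory.DiophantineGeometry.Word N (D * m)} (hw : x w ≠ 0)
    (r : Fin D) : m ≤ blockZeros w r + Y.rowLen 1 := by
  classical
  obtain ⟨a, ha⟩ := exists_sum_smul_polytabloid_eq hN hd hx
  -- symmetrise: `|W| • x = ∑ a_T S(e_T)`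
  have hS : (blockPermsFinset D m).card • x =
      ∑ T, a T • blockSymmetrizer k D m (T.polytabloid k hN) := by
    rw [← blockSymmetrizer_apply_of_forall_wordPerm_eq k hinv, ← ha, map_sum]
    simp_rw [map_smul]
  have hw' : ((blockPermsFinset D m).card • x) w ≠ 0 := by
    rw [Pi.smul_apply, nsmul_eq_mul]
    exact mul_ne_zero (Nat.cast_ne_zero.mpr card_blockPermsFinset_pos.ne') hw
  rw [hS, Finset.sum_apply] at hw'
  obtain ⟨T, -, hT⟩ := Finset.exists_ne_zero_of_sum_ne_zero hw'
  rw [Pi.smul_apply, smul_eq_mul] at hT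
  have hT' : blockSymmetrizer k D m (T.polytabloid k hN) w ≠ 0 := fun h => hT (by rw [h, mul_zero])
  -- `T` is good
  have hgood : ∀ p q, p ≠ q → (T.1 p).2 = (T.1 q).2 → blockIdx D m p ≠ blockIdx D m q := by
    intro p q hpq hcol hblk
    apply hT'
    rw [T.blockSymmetrizer_polytabloid_eq_zero hN hpq hcol hblk, Pi.zero_apply]
  -- some block permutation of `w` is in the support of `e_T`
  rw [blockSymmetrizer_apply] at hT'
  obtain ⟨τ, hτ, hτw⟩ := Finset.exists_ne_zero_of_sum_ne_zero hT'
  exact T.le_blockZeros_add_rowLen_of_polytabloid_comp_ne_zero hN hgood (mem_blockPermsFinset.mp hτ)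
    hτw r

/-- **The mechanism of BIP Prop. 5.8 (outer stability), word-model form.** Let `x` be a
highest-weight vector of weight `λ` (`λ` the shape of `Y`, `|Y| = D·m`, fewer than `N` rows) in
the word model of `V^{⊗ Dm}`. Then every word in the support of `x` has at least
`D - (λ₂ + |λ̄|)` blocks reading `0^m`: `D + λ₁ ≤ #(zero blocks) + |Y| + λ₂`. (No wreath
invariance is needed: every polytabloid has this support.) BIP, proof of Prop. 5.8: "there are
at least `d - (ν₂ + |ν̄|) ≥ d - k` many letters appearing in singleton columns of `T''` only."
[cite: BurgisserIkenmeyerPanovaJAMS2019, Prop. 5.8 (proof) with Prop. 4.5] -/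
theorem le_zeroBlocks_add_of_mem_highestWeightSpace [CharZero k]
    (hN : ∀ x ∈ Y.cells, x.1 < N) (hd : Y.cells.card = D * m) {x : Literature.NumberTheory.DiophantineGeometry.Word N (D * m) → k}
    (hx : x ∈ Literature.NumberTheory.DiophantineGeometry.highestWeightSpace (Literature.NumberTheory.DiophantineGeometry.wordRep k N (D * m)) (Literature.NumberTheory.DiophantineGeometry.ydWeight N Y)) {w : Literature.NumberTheory.DiophantineGeometry.Word N (D * m)}
    (hw : x w ≠ 0) : D + Y.rowLen 0 ≤ zeroBlocks w + Y.cells.card + Y.rowLen 1 := by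
  classical
  obtain ⟨a, ha⟩ := exists_sum_smul_polytabloid_eq hN hd hx
  rw [← ha, Finset.sum_apply] at hw
  obtain ⟨T, -, hT⟩ := Finset.exists_ne_zero_of_sum_ne_zero hw
  rw [Pi.smul_apply, smul_eq_mul] at hT
  have hT' : T.polytabloid k hN w ≠ 0 := fun h => hT (by rw [h, mul_zero])
  have h1 := T.le_zeroBlocks_add_card_of_polytabloid_ne_zero hN hT'
  have h2 := Y.card_filter_snd_lt_rowLen_one
  omega

end Support

end Literature.Computability.AlgebraicComplexity

/-! ### 5. Transport of highest-weight vectors of `k[Sym^n]_d` to the word model -/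

namespace Literature.Computability.AlgebraicComplexity

section Reindex

variable {k : Type*} [Field k] {ι κ : Type*} [Fintype ι] [DecidableEq ι] [Fintype κ] [DecidableEq κ]

/-- The element `b = ρ (g⁻¹)ᵀ ρ⁻¹ ∈ GL(k^σ)` attached to `g ∈ GL_M(k)` and a bijection
`ρ : Fin M ≃ σ`: `b_{ρ i, ρ j} = (g⁻¹)_{j i}`. For order-reversing `ρ` it is upper triangular when
`g` is, and it is the matrix through which `g` acts on the transported polarisation
(`wordOfForm_mem_highestWeightSpace`). [folklore] -/
def glReindexTransposeInv (ρ : ι ≃ κ) (g : GL ι k) : GL κ k where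
  val := Matrix.reindex ρ ρ ((g⁻¹ : GL ι k) : Matrix ι ι k).transpose
  inv := Matrix.reindex ρ ρ ((g : GL ι k) : Matrix ι ι k).transpose
  val_inv := by
    rw [Matrix.reindex_apply, Matrix.reindex_apply, Matrix.submatrix_mul_equiv,
      ← Matrix.transpose_mul, ← Units.val_mul, mul_inv_cancel, Units.val_one, Matrix.transpose_one,
      Matrix.submatrix_one_equiv]
  inv_val := by
    rw [Matrix.reindex_apply, Matrix.reindex_apply, Matrix.submatrix_mul_equiv,
      ← Matrix.transpose_mul, ← Units.val_mul, inv_mul_cancel, Units.val_one, Matrix.transpose_one,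
      Matrix.submatrix_one_equiv]

/-- Entries of `glReindexTransposeInv ρ g`: `b_{ρ i, ρ j} = (g⁻¹)_{j i}`. [folklore] -/
theorem glReindexTransposeInv_apply (ρ : ι ≃ κ) (g : GL ι k) (i j : ι) :
    (glReindexTransposeInv ρ g : Matrix κ κ k) (ρ i) (ρ j) =
      ((g⁻¹ : GL ι k) : Matrix ι ι k) j i := by
  simp [glReindexTransposeInv]

/-- Entries of the inverse: `(b⁻¹)_{ρ i, ρ j} = g_{j i}`. [folklore] -/
theorem glReindexTransposeInv_inv_apply (ρ : ι ≃ κ) (g : GL ι k) (i j : ι) :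
    ((glReindexTransposeInv ρ g)⁻¹ : GL κ k) (ρ i) (ρ j) =
      ((g : GL ι k) : Matrix ι ι k) j i := by
  change (glReindexTransposeInv ρ g).inv (ρ i) (ρ j) = _
  simp [glReindexTransposeInv]

/-- `ρ`-reindexing after `ρ⁻¹`-reindexing is the identity:
`glReindexTransposeInv ρ (glReindexTransposeInv ρ⁻¹ b) = b`. [folklore] -/
theorem glReindexTransposeInv_glReindexTransposeInv_symm (ρ : ι ≃ κ) (b : GL κ k) :
    glReindexTransposeInv ρ (glReindexTransposeInv ρ.symm b) = b := by
  apply Units.ext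
  change Matrix.reindex ρ ρ
    ((glReindexTransposeInv ρ.symm b)⁻¹ : GL ι k).1.transpose = (b : Matrix κ κ k)
  have : ((glReindexTransposeInv ρ.symm b)⁻¹ : GL ι k).1 =
      Matrix.reindex ρ.symm ρ.symm ((b : GL κ k) : Matrix κ κ k).transpose := rfl
  rw [this]
  ext a a'
  simp

end Reindex

section ReindexOrder

variable {k : Type*} [Field k] {ι κ : Type*} [Fintype ι] [LinearOrder ι] [Fintype κ] [LinearOrder κ]

/-- For order-reversing `ρ` and upper triangular `g`, `ρ (g⁻¹)ᵀ ρ⁻¹` is upper triangular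
(transposition and order reversal both swap the two Borel subgroups). [folklore] -/
theorem isUpperTriangular_glReindexTransposeInv {ρ : ι ≃ κ} (hρ : StrictAnti ρ)
    {g : GL ι k} (hg : Literature.NumberTheory.DiophantineGeometry.IsUpperTriangular g) :
    Literature.NumberTheory.DiophantineGeometry.IsUpperTriangular (glReindexTransposeInv ρ g) := by
  have hg' : Literature.NumberTheory.DiophantineGeometry.IsUpperTriangular g⁻¹ := (Literature.NumberTheory.DiophantineGeometry.borelSubgroup ι k).inv_mem hg
  intro a a' hlt
  obtain ⟨i, rfl⟩ := ρ.surjective a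
  obtain ⟨j, rfl⟩ := ρ.surjective a'
  rw [glReindexTransposeInv_apply]
  apply hg'.apply_eq_zero
  exact hρ.lt_iff_gt.mp hlt

/-- The weight character of `b = ρ (g⁻¹)ᵀ ρ⁻¹` at `χ` is that of the upper triangular `g` at
the weight `i ↦ -χ(ρ i)` (diagonal of the inverse of a triangular matrix). [folklore] -/
theorem weightChar_glReindexTransposeInv (ρ : ι ≃ κ) {g : GL ι k} (hg : Literature.NumberTheory.DiophantineGeometry.IsUpperTriangular g)
    (χ : Literature.NumberTheory.DiophantineGeometry.Weight κ) :
    Literature.NumberTheory.DiophantineGeometry.weightChar χ (glReindexTransposeInv ρ g) = Literature.NumberTheory.DiophantineGeometry.weightChar (fun i => -χ (ρ i)) g := by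
  rw [Literature.NumberTheory.DiophantineGeometry.weightChar, Literature.NumberTheory.DiophantineGeometry.weightChar]
  rw [← Fintype.prod_equiv ρ (fun i => (glReindexTransposeInv ρ g : Matrix κ κ k) (ρ i) (ρ i) ^ χ (ρ i))
    _ (fun _ => rfl)]
  refine Finset.prod_congr rfl fun i _ => ?_
  rw [glReindexTransposeInv_apply, inv_apply_diag_of_isUpperTriangular' hg, inv_zpow']

end ReindexOrder

section Transport

open MvPolynomial

variable {k : Type*} [Field k] {σ : Type*} [LinearOrder σ] [Fintype σ] {M : ℕ}

variable {n d : ℕ}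

/-- **A form on `Sym^n V^*` as a function on words** (`V = k^σ`, alphabet `Fin M` through a
bijection `ρ : Fin M ≃ σ`): the full polarisation `Φ(h)` (`polarize`, BIP §3(a)) of a form `h` of
degree `d` on `Sym^n`, read on flat words of length `d·n` (block `r` = the `r`-th inner word) and
with the letters renamed by `ρ`. With `ρ` order-reversing, `ρ 0` is the greatest variable (BIP's
`X_1`/`e_1`). BIP §4, (4.1): `Sym^d Sym^n V ⊆ ⊗^{dn} V`. [cite: BurgisserIkenmeyerPanovaJAMS2019, §4 (4.1)] -/
noncomputable def wordOfForm (ρ : Fin M ≃ σ) (n d : ℕ) (h : MvPolynomial (DegIdx σ n) k) :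
    Literature.NumberTheory.DiophantineGeometry.Word M (d * n) → k :=
  fun w => polarize n d h fun r p => ρ (w (finProdFinEquiv (r, p)))

/-- Unfolding lemma for `wordOfForm`. [folklore] -/
theorem wordOfForm_apply (ρ : Fin M ≃ σ) (h : MvPolynomial (DegIdx σ n) k) (w : Literature.NumberTheory.DiophantineGeometry.Word M (d * n)) :
    wordOfForm ρ n d h w = polarize n d h fun r p => ρ (w (finProdFinEquiv (r, p))) :=
  rfl

/-- The polarisation is linear (scalars). [folklore] -/
theorem polarize_smul (c : k) (h : MvPolynomial (DegIdx σ n) k) (u : Fin d → Fin n → σ) :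
    polarize n d (c • h) u = c * polarize n d h u := by
  rw [← polarizeLin_apply, map_smul, Pi.smul_apply, smul_eq_mul, polarizeLin_apply]

/-- **Equivariance of the transported polarisation**: for `g ∈ GL_M(k)` and
`b = ρ (g⁻¹)ᵀ ρ⁻¹ ∈ GL(k^σ)`, `wordOfForm (b · h) = g · wordOfForm h` (`coordRep` on the left,
`wordRep` on the right; `polarize_coordSubst` read on flat words). This is the equivariance of
`Sym^d Sym^n V ⊆ ⊗^{dn} V` (BIP §4) in the dual coordinates of the tree.
[cite: BurgisserIkenmeyerPanovaJAMS2019, §4 (4.1)] -/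
theorem wordOfForm_coordSubst [CharZero k] (ρ : Fin M ≃ σ) (g : GL (Fin M) k)
    {h : MvPolynomial (DegIdx σ n) k} (hh : h.IsHomogeneous d) :
    wordOfForm ρ n d (coordSubst n (glReindexTransposeInv ρ g) h) =
      Literature.NumberTheory.DiophantineGeometry.wordRep k M (d * n) g (wordOfForm ρ n d h) := by
  set b := glReindexTransposeInv ρ g with hb_def
  funext w'
  rw [Literature.NumberTheory.DiophantineGeometry.wordRep_apply, wordOfForm_apply, polarize_coordSubst b hh]
  -- reindex the sum over nested words by flat words
  let E : Literature.NumberTheory.DiophantineGeometry.Word M (d * n) ≃ (Fin d → Fin n → σ) :=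
    ((Equiv.refl (Fin (d * n))).arrowCongr ρ).trans (flattenWord (σ := σ) d n).symm
  symm
  refine Fintype.sum_equiv E
    (fun w => (∏ q, (g : Matrix (Fin M) (Fin M) k) (w' q) (w q)) * wordOfForm ρ n d h w)
    (fun v => (∏ r, ∏ p, ((b⁻¹ : GL σ k) : Matrix σ σ k) (v r p) (ρ (w' (finProdFinEquiv (r, p))))) *
      polarize n d h v) fun w => ?_
  have hE : ∀ r p, E w r p = ρ (w (finProdFinEquiv (r, p))) := fun r p => rfl
  have hEw : wordOfForm ρ n d h w = polarize n d h (E w) := rfl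
  rw [hEw]
  congr 1
  rw [← Fintype.prod_equiv finProdFinEquiv
    (fun x => (g : Matrix (Fin M) (Fin M) k) (w' (finProdFinEquiv x)) (w (finProdFinEquiv x)))
    _ (fun _ => rfl), Fintype.prod_prod_type]
  refine Finset.prod_congr rfl fun r _ => Finset.prod_congr rfl fun p _ => ?_
  rw [hE, hb_def, glReindexTransposeInv_inv_apply]

/-- `wordOfForm` is linear (scalars). [folklore] -/
theorem wordOfForm_smul (ρ : Fin M ≃ σ) (c : k) (h : MvPolynomial (DegIdx σ n) k) :
    wordOfForm ρ n d (c • h) = c • wordOfForm ρ n d h := by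
  funext w
  rw [wordOfForm_apply, polarize_smul, Pi.smul_apply, smul_eq_mul, wordOfForm_apply]

/-- `wordOfForm ρ n d` is injective on forms of degree `d` (the full polarisation is,
`eq_of_polarize_eq`). [folklore] -/
theorem eq_of_wordOfForm_eq [CharZero k] (ρ : Fin M ≃ σ) {F G : MvPolynomial (DegIdx σ n) k}
    (hF : F.IsHomogeneous d) (hG : G.IsHomogeneous d)
    (hFG : wordOfForm ρ n d F = wordOfForm ρ n d G) : F = G := by
  refine eq_of_polarize_eq hF hG (funext fun u => ?_)
  have := congrFun hFG (fun q => ρ.symm (u (finProdFinEquiv.symm q).1 (finProdFinEquiv.symm q).2))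
  rw [wordOfForm_apply, wordOfForm_apply] at this
  simpa only [Equiv.symm_apply_apply, Equiv.apply_symm_apply] using this

/-- **Transport of highest-weight vectors from `k[Sym^n]_d` to the tensor power.** If `h` is a
form of degree `d` on `Sym^n (k^σ)` and a highest-weight vector of weight `χ` for `coordRep`
(`(g·h)(q) = h(g⁻¹ q)`, upper triangular Borel of `σ`), and `ρ : Fin M ≃ σ` is order-reversing,
then `wordOfForm ρ n d h` is a highest-weight vector of the word model `wordRep k M (d n)` (upper
triangular Borel of `Fin M`) of weight `i ↦ -χ(ρ i)`. Proof: by the equivariance of the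
polarisation (`polarize_coordSubst`), `g ∈ B_M` acts on `wordOfForm h` as `b = ρ (g⁻¹)ᵀ ρ⁻¹ ∈ B_σ`
acts on `h`, and `χ(b) = ∏ g_{ii}^{-χ(ρ i)}`. This identifies BIP's highest-weight vectors of
weight `λ` in `Sym^d Sym^n V` (§3(b), §4) with the tree's highest-weight vectors of weight `λ^*`
in `k[Sym^n V^*]_d` (BLMW (5.2.2) duality convention of `coordRep`). [cite: BurgisserIkenmeyerPanovaJAMS2019, §3(b) and §4 (4.1)] -/
theorem wordOfForm_mem_highestWeightSpace [CharZero k] {ρ : Fin M ≃ σ} (hρ : StrictAnti ρ)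
    {h : MvPolynomial (DegIdx σ n) k} (hh : h.IsHomogeneous d) {χ : Literature.NumberTheory.DiophantineGeometry.Weight σ}
    (hχ : h ∈ Literature.NumberTheory.DiophantineGeometry.highestWeightSpace (coordRep σ k n) χ) :
    wordOfForm ρ n d h ∈ Literature.NumberTheory.DiophantineGeometry.highestWeightSpace (Literature.NumberTheory.DiophantineGeometry.wordRep k M (d * n)) (fun i => -χ (ρ i)) := by
  intro g hg
  have hb : Literature.NumberTheory.DiophantineGeometry.IsUpperTriangular (glReindexTransposeInv ρ g) := isUpperTriangular_glReindexTransposeInv hρ hg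
  rw [← wordOfForm_coordSubst ρ g hh, ← coordRep_apply, hχ _ hb, wordOfForm_smul,
    weightChar_glReindexTransposeInv ρ hg]

/-- **Transport of highest-weight vectors back from the tensor power to `k[Sym^n]_d`**: a form
`h` of degree `d` whose transported polarisation is a highest-weight vector of the word model of
weight `i ↦ -χ(ρ i)` is a highest-weight vector of `coordRep` of weight `χ` (equivariance and
injectivity of the polarisation; `b ∈ B_σ` acts as `g = ρ⁻¹ (b⁻¹)ᵀ ρ ∈ B_M`).
[cite: BurgisserIkenmeyerPanovaJAMS2019, §3(b) and §4 (4.1)] -/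
theorem mem_highestWeightSpace_of_wordOfForm_mem [CharZero k] {ρ : Fin M ≃ σ} (hρ : StrictAnti ρ)
    {h : MvPolynomial (DegIdx σ n) k} (hh : h.IsHomogeneous d) {χ : Literature.NumberTheory.DiophantineGeometry.Weight σ}
    (hx : wordOfForm ρ n d h ∈ Literature.NumberTheory.DiophantineGeometry.highestWeightSpace (Literature.NumberTheory.DiophantineGeometry.wordRep k M (d * n)) (fun i => -χ (ρ i))) :
    h ∈ Literature.NumberTheory.DiophantineGeometry.highestWeightSpace (coordRep σ k n) χ := by
  intro b hb
  have hρ' : StrictAnti ρ.symm := fun a a' h => by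
    rw [← hρ.lt_iff_gt, Equiv.apply_symm_apply, Equiv.apply_symm_apply]; exact h
  set g := glReindexTransposeInv ρ.symm b with hg_def
  have hg : Literature.NumberTheory.DiophantineGeometry.IsUpperTriangular g := isUpperTriangular_glReindexTransposeInv hρ' hb
  have hgb : glReindexTransposeInv ρ g = b := glReindexTransposeInv_glReindexTransposeInv_symm ρ b
  rw [coordRep_apply]
  refine eq_of_wordOfForm_eq ρ (isHomogeneous_coordSubst b hh) ?_ ?_
  · rw [smul_eq_C_mul]; exact hh.C_mul _
  rw [← hgb, wordOfForm_coordSubst ρ g hh, hx g hg, wordOfForm_smul,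
    weightChar_glReindexTransposeInv ρ hg]

/-- **`wordOfForm h` is invariant under the wreath product `S_d ≀ S_n`** (it lies in
`Sym^d Sym^n V ⊆ ⊗^{dn} V`, BIP (4.1)): a block permutation permutes the inner words and their
letters, and the polarisation depends only on the multiset of contents of the inner words
(`arrOf_comp_perm`, `wordExp_comp_perm`). [cite: BurgisserIkenmeyerPanovaJAMS2019, §4 (4.1)] -/
theorem wordOfForm_comp_of_mem_blockPerms (ρ : Fin M ≃ σ) (h : MvPolynomial (DegIdx σ n) k)
    {τ : Equiv.Perm (Fin (d * n))} (hτ : τ ∈ blockPerms d n) (w : Literature.NumberTheory.DiophantineGeometry.Word M (d * n)) :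
    wordOfForm ρ n d h (w ∘ ⇑τ) = wordOfForm ρ n d h w := by
  rcases Nat.eq_zero_or_pos n with hn | hn
  · subst hn
    have : (w ∘ ⇑τ : Literature.NumberTheory.DiophantineGeometry.Word M (d * 0)) = w := funext fun q => Fin.elim0 q
    rw [this]
  set u' : Fin d → Fin n → σ := fun r p => ρ (w (τ (finProdFinEquiv (r, p)))) with hu'
  set u : Fin d → Fin n → σ := fun r p => ρ (w (finProdFinEquiv (r, p))) with hu
  -- the induced permutation of the blocks
  set p₀ : Fin n := ⟨0, hn⟩
  let π₀ : Fin d → Fin d := fun r => blockIdx d n (τ (finProdFinEquiv (r, p₀)))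
  have hblk : ∀ r p, blockIdx d n (τ (finProdFinEquiv (r, p))) = π₀ r := fun r p => by
    show blockIdx d n (τ (finProdFinEquiv (r, p))) = blockIdx d n (τ (finProdFinEquiv (r, p₀)))
    rw [mem_blockPerms.mp hτ]
    simp
  have hπ₀ : Function.Injective π₀ := by
    intro r r' hrr'
    have h1 : blockIdx d n (τ (finProdFinEquiv (r, p₀))) = blockIdx d n (τ (finProdFinEquiv (r', p₀))) := hrr'
    rw [mem_blockPerms.mp hτ] at h1
    simpa using h1
  let π : Equiv.Perm (Fin d) := Equiv.ofBijective π₀ (Finite.injective_iff_bijective.mp hπ₀)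
  -- blockwise, `u' r` is a rearrangement of `u (π r)`
  have hword : ∀ r, wordExp (u' r) = wordExp (u (π r)) := by
    intro r
    let e₀ : Fin n → Fin n := fun p => (finProdFinEquiv.symm (τ (finProdFinEquiv (r, p)))).2
    have he₀ : ∀ p, τ (finProdFinEquiv (r, p)) = finProdFinEquiv (π r, e₀ p) := fun p => by
      show τ (finProdFinEquiv (r, p)) = finProdFinEquiv (π₀ r, e₀ p)
      rw [← hblk r p]
      exact (finProdFinEquiv_blockIdx _).symm
    have hinj : Function.Injective e₀ := by
      intro p p' hpp'
      have := (he₀ p).trans ((congrArg (fun q => finProdFinEquiv (π r, q)) hpp').trans (he₀ p').symm)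
      simpa using this
    let e : Equiv.Perm (Fin n) := Equiv.ofBijective e₀ (Finite.injective_iff_bijective.mp hinj)
    have : u' r = u (π r) ∘ ⇑e := by
      funext p
      simp only [hu', hu, Function.comp_apply]
      rw [he₀ p]
      rfl
    rw [this, wordExp_comp_perm]
  rw [wordOfForm_apply, wordOfForm_apply, polarize, polarize]
  have hfun : (fun r => (⟨wordExp (u' r), mem_degMonomials_iff.mpr (degree_wordExp _)⟩ : DegIdx σ n)) =
      (fun r => (⟨wordExp (u r), mem_degMonomials_iff.mpr (degree_wordExp _)⟩ : DegIdx σ n)) ∘ ⇑π := by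
    funext r
    exact Subtype.ext (hword r)
  change arrOf d h (fun r => (⟨wordExp (u' r), _⟩ : DegIdx σ n)) = arrOf d h (fun r => (⟨wordExp (u r), _⟩ : DegIdx σ n))
  rw [hfun, arrOf_comp_perm]

/-- The wreath invariance of `wordOfForm h` in `wordPerm` form. [cite: BurgisserIkenmeyerPanovaJAMS2019, §4 (4.1)] -/
theorem wordPerm_wordOfForm (ρ : Fin M ≃ σ) (h : MvPolynomial (DegIdx σ n) k)
    {τ : Equiv.Perm (Fin (d * n))} (hτ : τ ∈ blockPerms d n) :
    Literature.NumberTheory.DiophantineGeometry.wordPerm k τ (wordOfForm ρ n d h) = wordOfForm ρ n d h := by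
  funext w
  rw [Literature.NumberTheory.DiophantineGeometry.wordPerm_apply, wordOfForm_comp_of_mem_blockPerms ρ h hτ]

/-! ### The inverse dictionary: wreath-invariant functions on words are polarisations -/

/-- A chosen inner word of each content `e` (`|e| = n`; exists by `exists_wordExp_eq`). [folklore] -/
noncomputable def wordOfDegIdx (e : DegIdx σ n) : Fin n → σ :=
  (exists_wordExp_eq (σ := σ) e.1 (mem_degMonomials_iff.mp e.2)).choose

/-- The chosen word has the prescribed content. [folklore] -/
theorem wordExp_wordOfDegIdx (e : DegIdx σ n) : wordExp (wordOfDegIdx e) = e.1 :=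
  (exists_wordExp_eq (σ := σ) e.1 (mem_degMonomials_iff.mp e.2)).choose_spec

/-- The flat word (alphabet `Fin M` through `ρ`) whose `r`-th block is the chosen inner word of
content `E r`. [folklore] -/
noncomputable def flatOfContents (ρ : Fin M ≃ σ) (E : Fin d → DegIdx σ n) : Literature.NumberTheory.DiophantineGeometry.Word M (d * n) :=
  fun q => ρ.symm (wordOfDegIdx (E (finProdFinEquiv.symm q).1) (finProdFinEquiv.symm q).2)

/-- **From functions on words to forms on `Sym^n`**: `x ↦ ∑_E x(word of contents E) · ∏_r X_{E r}`,
a form of degree `d` whose transported polarisation is `x` when `x` is `S_d ≀ S_n`-invariant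
(`wordOfForm_formOfWord`): the inverse of the dictionary `wordOfForm` between `k[Sym^n V^*]_d`
and `Sym^d Sym^n V ≅ (⊗^{dn} V)^{S_d ≀ S_n}` (BIP (4.1): "`Sym^d Sym^n V` as the space of
`S_d ≀ S_n`-invariants in `⊗^{dn} V`"). [cite: BurgisserIkenmeyerPanovaJAMS2019, §4 (4.1)] -/
noncomputable def formOfWord (ρ : Fin M ≃ σ) (n d : ℕ) (x : Literature.NumberTheory.DiophantineGeometry.Word M (d * n) → k) :
    MvPolynomial (DegIdx σ n) k :=
  ∑ E : Fin d → DegIdx σ n, C (x (flatOfContents ρ E)) * ∏ r, X (E r)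

/-- `formOfWord x` is a form of degree `d`. [folklore] -/
theorem isHomogeneous_formOfWord (ρ : Fin M ≃ σ) (x : Literature.NumberTheory.DiophantineGeometry.Word M (d * n) → k) :
    (formOfWord ρ n d x).IsHomogeneous d := by
  refine IsHomogeneous.sum _ _ _ fun E _ => ?_
  have h := IsHomogeneous.prod (φ := fun r : Fin d => (X (E r) : MvPolynomial (DegIdx σ n) k))
    Finset.univ (fun _ => 1) fun r _ => isHomogeneous_X k (E r)
  rw [Finset.sum_const, Finset.card_univ, Fintype.card_fin, smul_eq_mul, mul_one] at h
  exact h.C_mul _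

/-- The block permutation `(r, p) ↦ (π r, p)` of `[d·n]` induced by a permutation `π ∈ S_d` of
the blocks (BIP §4: "the permutations of the form `(u-1)n + v ↦ (τ(u)-1)n + v` with `τ ∈ S_d`,
which simultaneously permute the blocks"). [cite: BurgisserIkenmeyerPanovaJAMS2019, §4] -/
def outerBlockPerm (d n : ℕ) (π : Equiv.Perm (Fin d)) : Equiv.Perm (Fin (d * n)) :=
  finProdFinEquiv.symm.trans ((Equiv.prodCongrLeft fun _ => π).trans finProdFinEquiv)

/-- `outerBlockPerm π` on position `(r, p)`. [folklore] -/
theorem outerBlockPerm_apply (π : Equiv.Perm (Fin d)) (r : Fin d) (p : Fin n) :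
    outerBlockPerm d n π (finProdFinEquiv (r, p)) = finProdFinEquiv (π r, p) := by
  simp [outerBlockPerm]

/-- Simultaneous permutations of the blocks lie in the wreath product. [cite: BurgisserIkenmeyerPanovaJAMS2019, §4] -/
theorem outerBlockPerm_mem_blockPerms (π : Equiv.Perm (Fin d)) :
    outerBlockPerm d n π ∈ blockPerms d n := by
  intro q q'
  obtain ⟨⟨r, p⟩, rfl⟩ := finProdFinEquiv.surjective q
  obtain ⟨⟨r', p'⟩, rfl⟩ := finProdFinEquiv.surjective q'
  rw [outerBlockPerm_apply, outerBlockPerm_apply]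
  simp only [blockIdx_finProdFinEquiv]
  exact π.injective.eq_iff

/-- The block permutation `(r, p) ↦ (r, e_r p)` of `[d·n]` induced by permutations `e_r ∈ S_n`
inside the blocks (BIP §4: "the permutations leaving the blocks invariant"). [cite: BurgisserIkenmeyerPanovaJAMS2019, §4] -/
def innerBlockPerm (d n : ℕ) (e : Fin d → Equiv.Perm (Fin n)) : Equiv.Perm (Fin (d * n)) :=
  finProdFinEquiv.symm.trans ((Equiv.prodCongrRight e).trans finProdFinEquiv)

/-- `innerBlockPerm e` on position `(r, p)`. [folklore] -/
theorem innerBlockPerm_apply (e : Fin d → Equiv.Perm (Fin n)) (r : Fin d) (p : Fin n) :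
    innerBlockPerm d n e (finProdFinEquiv (r, p)) = finProdFinEquiv (r, e r p) := by
  simp [innerBlockPerm]

/-- Permutations inside the blocks lie in the wreath product. [cite: BurgisserIkenmeyerPanovaJAMS2019, §4] -/
theorem innerBlockPerm_mem_blockPerms (e : Fin d → Equiv.Perm (Fin n)) :
    innerBlockPerm d n e ∈ blockPerms d n := by
  intro q q'
  obtain ⟨⟨r, p⟩, rfl⟩ := finProdFinEquiv.surjective q
  obtain ⟨⟨r', p'⟩, rfl⟩ := finProdFinEquiv.surjective q'
  rw [innerBlockPerm_apply, innerBlockPerm_apply]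
  simp only [blockIdx_finProdFinEquiv]

/-- Permuting the tuple of contents permutes the blocks of the associated flat word. [folklore] -/
theorem flatOfContents_comp_perm (ρ : Fin M ≃ σ) (E : Fin d → DegIdx σ n) (π : Equiv.Perm (Fin d)) :
    flatOfContents ρ (E ∘ ⇑π) = flatOfContents ρ E ∘ ⇑(outerBlockPerm d n π) := by
  funext q
  obtain ⟨⟨r, p⟩, rfl⟩ := finProdFinEquiv.surjective q
  rw [Function.comp_apply, outerBlockPerm_apply, flatOfContents, flatOfContents]
  simp only [Equiv.symm_apply_apply, Function.comp_apply]

/-- The array `E ↦ x(word of contents E)` of a wreath-invariant `x` is symmetric. [folklore] -/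
theorem apply_flatOfContents_comp_perm (ρ : Fin M ≃ σ) {x : Literature.NumberTheory.DiophantineGeometry.Word M (d * n) → k}
    (hx : ∀ τ ∈ blockPerms d n, Literature.NumberTheory.DiophantineGeometry.wordPerm k τ x = x) (E : Fin d → DegIdx σ n)
    (π : Equiv.Perm (Fin d)) : x (flatOfContents ρ (E ∘ ⇑π)) = x (flatOfContents ρ E) := by
  rw [flatOfContents_comp_perm, ← Literature.NumberTheory.DiophantineGeometry.wordPerm_apply k (outerBlockPerm d n π) x,
    hx _ (outerBlockPerm_mem_blockPerms π)]

/-- The array of `formOfWord x` is `E ↦ x(word of contents E)` (`x` wreath-invariant,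
characteristic zero; `arrOf_sum_C_mul_prod_X`). [folklore] -/
theorem arrOf_formOfWord [CharZero k] (ρ : Fin M ≃ σ) {x : Literature.NumberTheory.DiophantineGeometry.Word M (d * n) → k}
    (hx : ∀ τ ∈ blockPerms d n, Literature.NumberTheory.DiophantineGeometry.wordPerm k τ x = x) (E : Fin d → DegIdx σ n) :
    arrOf d (formOfWord ρ n d x) E = x (flatOfContents ρ E) :=
  arrOf_sum_C_mul_prod_X (fun I π => apply_flatOfContents_comp_perm ρ hx I π) E

/-- **`wordOfForm ∘ formOfWord = id` on `S_d ≀ S_n`-invariant functions**: every wreath-invariant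
function on words of length `dn` is the transported polarisation of a form of degree `d` on
`Sym^n` (surjectivity of the dictionary onto `(⊗^{dn} V)^{S_d ≀ S_n} = Sym^d Sym^n V`, BIP (4.1));
the chosen inner words are rearrangements of the blocks, absorbed by the inner symmetric groups.
[cite: BurgisserIkenmeyerPanovaJAMS2019, §4 (4.1)] -/
theorem wordOfForm_formOfWord [CharZero k] (ρ : Fin M ≃ σ) {x : Literature.NumberTheory.DiophantineGeometry.Word M (d * n) → k}
    (hx : ∀ τ ∈ blockPerms d n, Literature.NumberTheory.DiophantineGeometry.wordPerm k τ x = x) : wordOfForm ρ n d (formOfWord ρ n d x) = x := by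
  funext w
  rw [wordOfForm_apply, polarize, arrOf_formOfWord ρ hx]
  -- the chosen inner words are rearrangements of the blocks of `w`
  set E : Fin d → DegIdx σ n := fun r =>
    ⟨wordExp fun p => ρ (w (finProdFinEquiv (r, p))), mem_degMonomials_iff.mpr (degree_wordExp _)⟩ with hE
  have hperm : ∀ r, ∃ e : Equiv.Perm (Fin n),
      (fun p => ρ (w (finProdFinEquiv (r, p)))) ∘ ⇑e = wordOfDegIdx (E r) := fun r =>
    exists_comp_perm_eq_of_wordExp_eq (by rw [wordExp_wordOfDegIdx])
  choose e he using hperm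
  have hflat : flatOfContents ρ E = w ∘ ⇑(innerBlockPerm d n e) := by
    funext q
    obtain ⟨⟨r, p⟩, rfl⟩ := finProdFinEquiv.surjective q
    rw [Function.comp_apply, innerBlockPerm_apply, flatOfContents]
    simp only [Equiv.symm_apply_apply]
    rw [Equiv.symm_apply_eq, ← he r, Function.comp_apply]
  rw [hflat, ← Literature.NumberTheory.DiophantineGeometry.wordPerm_apply k (innerBlockPerm d n e) x, hx _ (innerBlockPerm_mem_blockPerms e)]

/-- **`formOfWord ∘ wordOfForm = id` on forms of degree `d`**: the dictionary is a bijection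
between `k[Sym^n (k^σ)]_d` and the `S_d ≀ S_n`-invariant functions on words. [cite: BurgisserIkenmeyerPanovaJAMS2019, §4 (4.1)] -/
theorem formOfWord_wordOfForm [CharZero k] (ρ : Fin M ≃ σ) {h : MvPolynomial (DegIdx σ n) k}
    (hh : h.IsHomogeneous d) : formOfWord ρ n d (wordOfForm ρ n d h) = h :=
  eq_of_wordOfForm_eq ρ (isHomogeneous_formOfWord ρ _) hh
    (wordOfForm_formOfWord ρ fun _ hτ => wordPerm_wordOfForm ρ h hτ)

/-- A nonzero wreath-invariant function comes from a nonzero form. [folklore] -/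
theorem formOfWord_ne_zero [CharZero k] (ρ : Fin M ≃ σ) {x : Literature.NumberTheory.DiophantineGeometry.Word M (d * n) → k}
    (hx : ∀ τ ∈ blockPerms d n, Literature.NumberTheory.DiophantineGeometry.wordPerm k τ x = x) (hx0 : x ≠ 0) : formOfWord ρ n d x ≠ 0 := by
  intro h0
  apply hx0
  rw [← wordOfForm_formOfWord ρ hx, h0]
  funext w
  rw [wordOfForm_apply, polarize, arrOf, coeff_zero, zero_div, Pi.zero_apply]

/-- **Highest-weight vectors of the plethysm, from the word model to polynomials**: a
wreath-invariant highest-weight vector `x` of the word model of `V^{⊗dn}` (`V = k^σ`, alphabet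
through the order-reversing `ρ`) of weight `i ↦ -χ(ρ i)` gives the highest-weight vector
`formOfWord x ∈ k[Sym^n]_d` of `coordRep` of weight `χ` (nonzero if `x` is, `formOfWord_ne_zero`).
This is the passage from BIP's `HWV_λ(Sym^d Sym^n V)` — e.g. the tableau vectors `v_T` of §4 and
§7 — to highest-weight vectors of `k[Sym^n V^*]_d` and hence to occurrence statements; it is the
entry point for a future discharge of Prop. 7.3. [cite: BurgisserIkenmeyerPanovaJAMS2019, §4(a) and (4.1)] -/
theorem formOfWord_mem_highestWeightSpace [CharZero k] {ρ : Fin M ≃ σ} (hρ : StrictAnti ρ)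
    {x : Literature.NumberTheory.DiophantineGeometry.Word M (d * n) → k} (hx : ∀ τ ∈ blockPerms d n, Literature.NumberTheory.DiophantineGeometry.wordPerm k τ x = x) {χ : Literature.NumberTheory.DiophantineGeometry.Weight σ}
    (hxw : x ∈ Literature.NumberTheory.DiophantineGeometry.highestWeightSpace (Literature.NumberTheory.DiophantineGeometry.wordRep k M (d * n)) (fun i => -χ (ρ i))) :
    formOfWord ρ n d x ∈ Literature.NumberTheory.DiophantineGeometry.highestWeightSpace (coordRep σ k n) χ :=
  mem_highestWeightSpace_of_wordOfForm_mem hρ (isHomogeneous_formOfWord ρ x)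
    (by rw [wordOfForm_formOfWord ρ hx]; exact hxw)

end Transport

end Literature.Computability.AlgebraicComplexity

/-! ### 6. Consequences in `k[Sym^n]`: supports of monomials, factorisation, inner lowering -/

namespace Literature.Computability.AlgebraicComplexity

open MvPolynomial

section Monomials

variable {k : Type*} [Field k] {σ : Type*} [DecidableEq σ] [Fintype σ] {n d : ℕ}

/-- In characteristic zero an entry of the array of a form vanishes iff the corresponding
coefficient does (the fibre of a word under `wordExp` is nonempty). [folklore] -/
theorem arrOf_ne_zero_iff [CharZero k] {ℓ : ℕ} (q : MvPolynomial σ k) (J : Fin ℓ → σ) :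
    arrOf ℓ q J ≠ 0 ↔ coeff (wordExp J) q ≠ 0 := by
  rw [arrOf, div_ne_zero_iff, and_iff_left]
  rw [Nat.cast_ne_zero, ← Nat.pos_iff_ne_zero, Finset.card_pos]
  exact ⟨J, by simp⟩

/-- Every monomial of a form of degree `d` on `Sym^n` is reached by the polarisation: for
`s ∈ supp h` there are inner words `u` whose contents multiply to `X^s` and with `Φ(h)(u) ≠ 0`.
[folklore] -/
theorem exists_words_of_mem_support [CharZero k] {h : MvPolynomial (DegIdx σ n) k}
    (hh : h.IsHomogeneous d) {s : DegIdx σ n →₀ ℕ} (hs : s ∈ h.support) :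
    ∃ u : Fin d → Fin n → σ,
      wordExp (fun r => (⟨wordExp (u r), mem_degMonomials_iff.mpr (degree_wordExp _)⟩ : DegIdx σ n)) = s
        ∧ polarize n d h u ≠ 0 := by
  classical
  obtain ⟨E, hE⟩ := exists_wordExp_eq (ℓ := d) s (by
    rw [Finsupp.degree_eq_weight_one]
    exact hh (mem_support_iff.mp hs))
  choose u hu using fun r => exists_wordExp_eq (σ := σ) (E r).1 (mem_degMonomials_iff.mp (E r).2)
  have hEu : (fun r => (⟨wordExp (u r), mem_degMonomials_iff.mpr (degree_wordExp _)⟩ : DegIdx σ n)) = E :=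
    funext fun r => Subtype.ext (hu r)
  refine ⟨u, by rw [hEu, hE], ?_⟩
  rw [polarize, hEu, arrOf_ne_zero_iff, hE]
  exact mem_support_iff.mp hs

/-- **From letter counts to exponents.** If `Φ(h)(u) ≠ 0` forces every inner word `u r` to
contain the letter `i` at least `t` times, then every coordinate `X_e` occurring in `h` has
`e i ≥ t`. [folklore] -/
theorem le_apply_of_mem_support_of_polarize [CharZero k] {h : MvPolynomial (DegIdx σ n) k}
    (hh : h.IsHomogeneous d) (i : σ) (t : ℕ)
    (hP : ∀ u : Fin d → Fin n → σ, polarize n d h u ≠ 0 →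
      ∀ r, t ≤ (Finset.univ.filter fun p => u r p = i).card)
    {s : DegIdx σ n →₀ ℕ} (hs : s ∈ h.support) {e : DegIdx σ n} (he : e ∈ s.support) :
    t ≤ e.1 i := by
  classical
  obtain ⟨u, hus, hu⟩ := exists_words_of_mem_support hh hs
  rw [← hus, Finsupp.mem_support_iff, wordExp_apply, ← Nat.pos_iff_ne_zero, Finset.card_pos] at he
  obtain ⟨r, hr⟩ := he
  simp only [Finset.mem_filter, Finset.mem_univ, true_and] at hr
  rw [← hr]
  change t ≤ wordExp (u r) i
  rw [wordExp_apply]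
  exact hP u hu r

omit [DecidableEq σ] [Fintype σ] in
/-- The content of a constant word is `n ε_i`. [folklore] -/
theorem wordExp_const (i : σ) : wordExp (fun _ : Fin n => i) = Finsupp.single i n := by
  rw [wordExp, Finset.sum_const, Finset.card_univ, Fintype.card_fin, Finsupp.smul_single', mul_one]

/-- **From constant inner words to divisibility.** If `Φ(h)(u) ≠ 0` forces at least `t` of the
inner words `u r` to be the constant word `i^n`, then every monomial of `h` contains the
coordinate `X_{x_i^n}` at least `t` times. [folklore] -/
theorem le_apply_single_of_mem_support_of_polarize [CharZero k] {h : MvPolynomial (DegIdx σ n) k}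
    (hh : h.IsHomogeneous d) (i : σ) (t : ℕ)
    (hP : ∀ u : Fin d → Fin n → σ, polarize n d h u ≠ 0 →
      t ≤ (Finset.univ.filter fun r => u r = fun _ => i).card)
    {s : DegIdx σ n →₀ ℕ} (hs : s ∈ h.support) :
    t ≤ s ⟨Finsupp.single i n, mem_degMonomials_iff.mpr (Finsupp.degree_single _ _)⟩ := by
  classical
  obtain ⟨u, hus, hu⟩ := exists_words_of_mem_support hh hs
  rw [← hus, wordExp_apply]
  refine (hP u hu).trans (Finset.card_le_card fun r hr => ?_)
  simp only [Finset.mem_filter, Finset.mem_univ, true_and] at hr ⊢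
  apply Subtype.ext
  simp only [hr, wordExp_const]

/-- **Factorisation by a power of a variable**: if every monomial of `f` is divisible by `X_e₀^t`
then `f = X_e₀^t · ∑_s coeff_s(f) x^{s - t e₀}`. [folklore] -/
theorem eq_X_pow_mul_of_le_apply {ι : Type*} (f : MvPolynomial ι k) (e₀ : ι) (t : ℕ)
    (hf : ∀ s ∈ f.support, t ≤ s e₀) :
    f = X e₀ ^ t * ∑ s ∈ f.support, monomial (s - Finsupp.single e₀ t) (coeff s f) := by
  classical
  rw [Finset.mul_sum]
  conv_lhs => rw [← f.support_sum_monomial_coeff]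
  refine Finset.sum_congr rfl fun s hs => ?_
  have hs' : Finsupp.single e₀ t + (s - Finsupp.single e₀ t) = s := by
    ext j
    simp only [Finsupp.coe_add, Finsupp.coe_tsub, Pi.add_apply, Pi.sub_apply, Finsupp.single_apply]
    have := hf s hs
    split_ifs with h
    · subst h; omega
    · omega
  rw [X_pow_eq_monomial, monomial_mul, one_mul, hs']

/-- The cofactor in `eq_X_pow_mul_of_le_apply` is a form of degree `D - t` when `f` is a form of
degree `D`. [folklore] -/
theorem isHomogeneous_sum_monomial_sub {ι : Type*} {f : MvPolynomial ι k} {D : ℕ}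
    (hf : f.IsHomogeneous D) (e₀ : ι) (t : ℕ) (hft : ∀ s ∈ f.support, t ≤ s e₀) :
    (∑ s ∈ f.support, monomial (s - Finsupp.single e₀ t) (coeff s f)).IsHomogeneous (D - t) := by
  classical
  refine IsHomogeneous.sum _ _ _ fun s hs => isHomogeneous_monomial _ ?_
  have hdeg : Finsupp.weight (1 : ι → ℕ) s = D := hf (mem_support_iff.mp hs)
  have hsplit : s - Finsupp.single e₀ t + Finsupp.single e₀ t = s := by
    ext j
    simp only [Finsupp.coe_add, Finsupp.coe_tsub, Pi.add_apply, Pi.sub_apply, Finsupp.single_apply]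
    have := hft s hs
    split_ifs with h
    · subst h; omega
    · omega
  have h2 := congrArg (Finsupp.weight (1 : ι → ℕ)) hsplit
  rw [map_add, hdeg] at h2
  have h3 : Finsupp.weight (1 : ι → ℕ) (Finsupp.single e₀ t) = t := by
    rw [Finsupp.weight_single, Pi.one_apply, smul_eq_mul, mul_one]
  rw [h3] at h2
  have h4 : Finsupp.weight (1 : ι → ℕ) (s - Finsupp.single e₀ t) = (s - Finsupp.single e₀ t).degree := by
    rw [Finsupp.degree_eq_weight_one]; rfl
  omega

end Monomials

/-! ### Highest-weight spaces of `k[Sym^m]` multiply; cancelling a highest-weight factor -/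

section HWMul

variable {k : Type*} [Field k] {σ : Type*} [LinearOrder σ] [Fintype σ] {m : ℕ}

/-- Products of highest-weight vectors of `k[Sym^m]` are highest-weight vectors, of the sum of
the weights (`GL` acts by algebra automorphisms; BIP §5(c): "Since `GL(V)` acts on `Sym V` by
algebra automorphisms, (5.8) maps a highest weight vector of weight `ν` to a highest weight
vector of weight `ν♯`"). [cite: BurgisserIkenmeyerPanovaJAMS2019, §5(c)] -/
theorem mul_mem_highestWeightSpace_coordRep {χ ψ : Literature.NumberTheory.DiophantineGeometry.Weight σ} {F G : MvPolynomial (DegIdx σ m) k}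
    (hF : F ∈ Literature.NumberTheory.DiophantineGeometry.highestWeightSpace (coordRep σ k m) χ) (hG : G ∈ Literature.NumberTheory.DiophantineGeometry.highestWeightSpace (coordRep σ k m) ψ) :
    F * G ∈ Literature.NumberTheory.DiophantineGeometry.highestWeightSpace (coordRep σ k m) (χ + ψ) := by
  intro g hg
  rw [coordRep_apply, map_mul, ← coordRep_apply, ← coordRep_apply, hF g hg, hG g hg,
    Literature.NumberTheory.DiophantineGeometry.weightChar_add χ ψ hg, smul_mul_smul_comm, mul_smul, smul_smul]

/-- Powers of a highest-weight vector of `k[Sym^m]`. [cite: BurgisserIkenmeyerPanovaJAMS2019, §5(c)] -/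
theorem pow_mem_highestWeightSpace_coordRep {χ : Literature.NumberTheory.DiophantineGeometry.Weight σ} {F : MvPolynomial (DegIdx σ m) k}
    (hF : F ∈ Literature.NumberTheory.DiophantineGeometry.highestWeightSpace (coordRep σ k m) χ) (t : ℕ) :
    F ^ t ∈ Literature.NumberTheory.DiophantineGeometry.highestWeightSpace (coordRep σ k m) (t • χ) := by
  induction t with
  | zero =>
    intro g hg
    simp [Literature.NumberTheory.DiophantineGeometry.weightChar]
  | succ t ih =>
    rw [pow_succ, succ_nsmul]
    exact mul_mem_highestWeightSpace_coordRep ih hF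

/-- **Cancelling a nonzero highest-weight factor**: if `F ≠ 0` is a highest-weight vector of
weight `χ` and `F · G` one of weight `ψ`, then `G` is a highest-weight vector of weight `ψ - χ`
(`k[Sym^m]` is a domain and weight characters of upper triangular matrices are units). The
injectivity half of BIP Prop. 5.8(1) for the dual outer lifting `G ↦ X^{d-k} G`. [cite: BurgisserIkenmeyerPanovaJAMS2019, Prop. 5.8 (1)] -/
theorem mem_highestWeightSpace_of_mul {χ ψ : Literature.NumberTheory.DiophantineGeometry.Weight σ} {F G : MvPolynomial (DegIdx σ m) k}
    (hF : F ∈ Literature.NumberTheory.DiophantineGeometry.highestWeightSpace (coordRep σ k m) χ) (hF0 : F ≠ 0)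
    (hFG : F * G ∈ Literature.NumberTheory.DiophantineGeometry.highestWeightSpace (coordRep σ k m) ψ) :
    G ∈ Literature.NumberTheory.DiophantineGeometry.highestWeightSpace (coordRep σ k m) (ψ - χ) := by
  intro g hg
  have h1 := hFG g hg
  rw [coordRep_apply, map_mul, ← coordRep_apply, hF g hg, smul_mul_assoc, ← coordRep_apply] at h1
  have hne : Literature.NumberTheory.DiophantineGeometry.weightChar χ g ≠ 0 := Literature.NumberTheory.DiophantineGeometry.weightChar_ne_zero χ hg
  have h2 : F * (Literature.NumberTheory.DiophantineGeometry.weightChar χ g • coordRep σ k m g G - Literature.NumberTheory.DiophantineGeometry.weightChar ψ g • G) = 0 := by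
    rw [mul_sub, mul_smul_comm, h1, mul_smul_comm, sub_self]
  have h3 : Literature.NumberTheory.DiophantineGeometry.weightChar χ g • coordRep σ k m g G = Literature.NumberTheory.DiophantineGeometry.weightChar ψ g • G :=
    sub_eq_zero.mp ((mul_eq_zero.mp h2).resolve_left hF0)
  have h4 := congrArg (fun P => (Literature.NumberTheory.DiophantineGeometry.weightChar χ g)⁻¹ • P) h3
  simp only [smul_smul, inv_mul_cancel₀ hne, one_smul] at h4
  rw [h4]
  congr 1
  have hsub : ψ = (ψ - χ) + χ := (sub_add_cancel ψ χ).symm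
  conv_lhs => rw [hsub, Literature.NumberTheory.DiophantineGeometry.weightChar_add _ _ hg]
  field_simp

end HWMul

/-! ### The inner lowering: a partial inverse of `innerLift` -/

section Lower

variable {k : Type*} [Field k] {σ : Type*} [DecidableEq σ] [Fintype σ]

omit [Fintype σ] in
/-- Degree of `e - r ε_i` when `r ≤ e i`. [folklore] -/
theorem degree_tsub_single {e : σ →₀ ℕ} {i : σ} {r : ℕ} (h : r ≤ e i) :
    (e - Finsupp.single i r).degree = e.degree - r := by
  have hsplit : e - Finsupp.single i r + Finsupp.single i r = e := by
    ext j
    simp only [Finsupp.coe_add, Finsupp.coe_tsub, Pi.add_apply, Pi.sub_apply, Finsupp.single_apply]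
    split_ifs with hj
    · subst hj; omega
    · omega
  have := congrArg Finsupp.degree hsplit
  rw [map_add, Finsupp.degree_single] at this
  omega

/-- **The dual inner lifting on a coordinate is a nonzero multiple of a coordinate**:
`innerLift (X_d) = (d_i + r)!/(d_i)! · X_{d + r ε_i}`, `r = n - m` — the dual of BIP Lemma 5.1 /
(5.2) (`M^*(X^β) ∝ β_1 (β_1 - 1) ⋯ (β_1 - n + m + 1) X^{β - δ}`). [cite: BurgisserIkenmeyerPanovaJAMS2019, Lemma 5.1 (proof)] -/
theorem innerLift_X_eq_smul (i : σ) {m n : ℕ} (d : DegIdx σ m) (e : DegIdx σ n)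
    (he : e.1 = d.1 + Finsupp.single i (n - m)) :
    innerLift i m n (X d : MvPolynomial (DegIdx σ m) k) =
      (((d.1 i + (n - m)).descFactorial (n - m) : ℕ) : k) • X e := by
  classical
  rw [innerLift_X, Finset.sum_eq_single e]
  · rw [iterPderiv_monomial, coeff_monomial, he]
    have h1 : d.1 + Finsupp.single i (n - m) - Finsupp.single i (n - m) = d.1 := by
      ext j
      simp only [Finsupp.coe_tsub, Finsupp.coe_add, Pi.sub_apply, Pi.add_apply, Finsupp.single_apply]
      split_ifs <;> omega
    rw [if_pos h1, one_mul, Finsupp.add_apply, Finsupp.single_eq_same]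
  · intro e' _ hne
    rw [iterPderiv_monomial, coeff_monomial, one_mul]
    by_cases hlt : e'.1 i < n - m
    · rw [Nat.descFactorial_eq_zero_iff_lt.mpr hlt, Nat.cast_zero, ite_self, zero_smul]
    · rw [if_neg, zero_smul]
      intro h
      apply hne
      apply Subtype.ext
      rw [he, ← h]
      ext j
      simp only [Finsupp.coe_tsub, Finsupp.coe_add, Pi.sub_apply, Pi.add_apply, Finsupp.single_apply]
      split_ifs with hj
      · subst hj; omega
      · omega
  · intro h; exact absurd (Finset.mem_univ e) h

/-- **The inner lowering**, a partial inverse of the dual inner lifting `innerLift i m n` on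
coordinates: `X_e ↦ ((e_i)!/(e_i - r)!)⁻¹ X_{e - r ε_i}` if `e_i ≥ r = n - m` (and `m ≤ n`), and
`X_e ↦ 0` otherwise. It inverts `innerLift` on its image, the subalgebra generated by the `X_e`
with `e_i ≥ n - m` (`innerLower_comp_innerLift`, `innerLift_innerLower_of_forall_le`); dual to
BIP's "we can therefore shorten the given `λ` to a partition `μ ⊢ md` by removing singleton
columns" (proof of Prop. 5.6(2)). [cite: BurgisserIkenmeyerPanovaJAMS2019, Prop. 5.6 (2) (proof)] -/
noncomputable def innerLower (i : σ) (m n : ℕ) :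
    MvPolynomial (DegIdx σ n) k →ₐ[k] MvPolynomial (DegIdx σ m) k :=
  aeval fun e : DegIdx σ n =>
    if h : n - m ≤ e.1 i ∧ m ≤ n then
      ((((e.1 i).descFactorial (n - m) : ℕ) : k)⁻¹) •
        X (⟨e.1 - Finsupp.single i (n - m), mem_degMonomials_iff.mpr (by
          rw [degree_tsub_single h.1, mem_degMonomials_iff.mp e.2]; omega)⟩ : DegIdx σ m)
    else 0

/-- `innerLower` on a coordinate `X_e` with `e_i ≥ n - m`. [folklore] -/
theorem innerLower_X_of_le (i : σ) {m n : ℕ} (hmn : m ≤ n) (e : DegIdx σ n) (he : n - m ≤ e.1 i)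
    (d : DegIdx σ m) (hd : d.1 = e.1 - Finsupp.single i (n - m)) :
    innerLower i m n (X e : MvPolynomial (DegIdx σ n) k) =
      ((((e.1 i).descFactorial (n - m) : ℕ) : k)⁻¹) • X d := by
  rw [innerLower, aeval_X, dif_pos ⟨he, hmn⟩]
  congr 2
  exact Subtype.ext hd.symm

/-- `innerLower` kills the coordinates `X_e` with `e_i < n - m`. [folklore] -/
theorem innerLower_X_of_lt (i : σ) {m n : ℕ} (e : DegIdx σ n) (he : e.1 i < n - m) :
    innerLower i m n (X e : MvPolynomial (DegIdx σ n) k) = 0 := by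
  rw [innerLower, aeval_X, dif_neg]
  exact fun h => absurd h.1 (not_le.mpr he)

/-- `innerLower ∘ innerLift = id` (`m ≤ n`, characteristic zero). [cite: BurgisserIkenmeyerPanovaJAMS2019, §5(b)] -/
theorem innerLower_comp_innerLift [CharZero k] (i : σ) {m n : ℕ} (hmn : m ≤ n) :
    (innerLower i m n).comp (innerLift i m n) =
      AlgHom.id k (MvPolynomial (DegIdx σ m) k) := by
  refine MvPolynomial.algHom_ext fun d => ?_
  rw [AlgHom.comp_apply, AlgHom.id_apply]
  set e : DegIdx σ n := ⟨d.1 + Finsupp.single i (n - m), mem_degMonomials_iff.mpr (by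
    rw [map_add, Finsupp.degree_single, mem_degMonomials_iff.mp d.2]; omega)⟩ with he
  rw [innerLift_X_eq_smul i d e rfl, map_smul,
    innerLower_X_of_le i hmn e (by simp [he]) d (by
      rw [he]; ext j
      simp only [Finsupp.coe_tsub, Finsupp.coe_add, Pi.sub_apply, Pi.add_apply, Finsupp.single_apply]
      split_ifs <;> omega),
    smul_smul]
  have hei : e.1 i = d.1 i + (n - m) := by simp [he]
  rw [hei, mul_inv_cancel₀, one_smul]
  exact Nat.cast_ne_zero.mpr (descFactorial_add_pos _ _).ne'

/-- **The dual inner lifting is injective** (`m ≤ n`, characteristic zero); BIP §5(b): "Clearly,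
`κ_{m,n}^d` is an injective linear map", and dually `M^*` is surjective (§5(a)). [cite: BurgisserIkenmeyerPanovaJAMS2019, §5(b)] -/
theorem innerLift_injective [CharZero k] (i : σ) {m n : ℕ} (hmn : m ≤ n) :
    Function.Injective (innerLift (k := k) i m n) := by
  intro F G hFG
  have := congrArg (innerLower (k := k) i m n) hFG
  rwa [← AlgHom.comp_apply, ← AlgHom.comp_apply, innerLower_comp_innerLift i hmn] at this

/-- **`innerLift ∘ innerLower = id` on the forms in the coordinates `X_e` with `e_i ≥ n - m`**:
such forms are inner liftings. [cite: BurgisserIkenmeyerPanovaJAMS2019, Prop. 5.6 (2) (proof)] -/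
theorem innerLift_innerLower_of_forall_le [CharZero k] (i : σ) {m n : ℕ} (hmn : m ≤ n)
    {h : MvPolynomial (DegIdx σ n) k}
    (hsupp : ∀ s ∈ h.support, ∀ e ∈ s.support, n - m ≤ e.1 i) :
    innerLift i m n (innerLower i m n h) = h := by
  classical
  set Φ := (innerLift (k := k) i m n).comp (innerLower i m n) with hΦ
  have hX : ∀ e : DegIdx σ n, n - m ≤ e.1 i → Φ (X e) = X e := by
    intro e he
    set d : DegIdx σ m := ⟨e.1 - Finsupp.single i (n - m), mem_degMonomials_iff.mpr (by
      rw [degree_tsub_single he, mem_degMonomials_iff.mp e.2]; omega)⟩ with hd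
    have hed : e.1 = d.1 + Finsupp.single i (n - m) := by
      rw [hd]; ext j
      simp only [Finsupp.coe_tsub, Finsupp.coe_add, Pi.sub_apply, Pi.add_apply, Finsupp.single_apply]
      split_ifs with hj
      · subst hj; omega
      · omega
    rw [hΦ, AlgHom.comp_apply, innerLower_X_of_le i hmn e he d rfl, map_smul,
      innerLift_X_eq_smul i d e hed, smul_smul]
    have hdi : d.1 i + (n - m) = e.1 i := by
      rw [hd]
      simp only [Finsupp.coe_tsub, Pi.sub_apply, Finsupp.single_eq_same]
      omega
    rw [hdi, inv_mul_cancel₀, one_smul]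
    exact Nat.cast_ne_zero.mpr fun h0 => absurd (Nat.descFactorial_eq_zero_iff_lt.mp h0) (not_lt.mpr he)
  change Φ h = h
  conv_rhs => rw [← h.support_sum_monomial_coeff]
  conv_lhs => rw [← h.support_sum_monomial_coeff]
  rw [map_sum]
  refine Finset.sum_congr rfl fun s hs => ?_
  rw [monomial_eq, map_mul, MvPolynomial.algHom_C]
  congr 1
  change Φ (s.prod fun e r => X e ^ r) = s.prod fun e r => X e ^ r
  rw [Finsupp.prod, map_prod]
  refine Finset.prod_congr rfl fun e he => ?_
  rw [map_pow, hX e (hsupp s hs e he)]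

/-- `innerLower` preserves forms of degree `D` (every coordinate goes to a multiple of a
coordinate or to `0`). [folklore] -/
theorem isHomogeneous_innerLower (i : σ) {m n D : ℕ} {h : MvPolynomial (DegIdx σ n) k}
    (hh : h.IsHomogeneous D) : (innerLower i m n h).IsHomogeneous D := by
  unfold innerLower
  rw [← one_mul D]
  refine hh.aeval _ fun e => ?_
  split_ifs
  · rw [smul_eq_C_mul]; exact (isHomogeneous_X k _).C_mul _
  · exact isHomogeneous_zero _ _ _

end Lower

end Literature.Computability.AlgebraicComplexity

/-! ### 7. Main theorems: the supports of highest-weight vectors of `k[Sym^n]_d` -/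

namespace Literature.Computability.AlgebraicComplexity

open MvPolynomial

section Main

variable {k : Type*} [Field k] [CharZero k] {σ : Type*} [LinearOrder σ] [Fintype σ] {M : ℕ} [NeZero M]
  {n d : ℕ}

/-- **BIP Prop. 5.6(2), support form (with Prop. 4.5 and Lemma 4.3(1)).** Let
`ρ : Fin M ≃ σ` be order-reversing, `λ ⊢ d·n` a partition with at most `M` parts, and `h` a form
of degree `d` on `Sym^n (k^σ)` which is a highest-weight vector of `coordRep` of weight `χ` with
`-χ(ρ i) = λ_{i+1}` (i.e. `χ = λ^*` read through `ρ`). Then every coordinate `X_e` occurring in a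
monomial of `h` has exponent at least `n - λ₂` at the greatest variable `ρ 0`:
`n ≤ e(ρ 0) + λ₂`. This is BIP's "each of the `d` letters appears at least `n - λ₂` times in
singleton columns" for every tableau `T'` in the expansion of the highest-weight vector
(proof of Prop. 5.6), transported to `k[Sym^n]_d` by the polarisation. [cite: BurgisserIkenmeyerPanovaJAMS2019, Prop. 5.6 (2)] -/
theorem le_apply_add_of_mem_highestWeightSpace_coordRep {ρ : Fin M ≃ σ} (hρ : StrictAnti ρ)
    (lam : Nat.Partition (d * n)) (hlam : lam.parts.card ≤ M)
    {h : MvPolynomial (DegIdx σ n) k} (hh : h.IsHomogeneous d) {χ : Literature.NumberTheory.DiophantineGeometry.Weight σ}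
    (hχ : ∀ i, -χ (ρ i) = Literature.NumberTheory.DiophantineGeometry.Weight.ofPartition M lam i)
    (hhw : h ∈ Literature.NumberTheory.DiophantineGeometry.highestWeightSpace (coordRep σ k n) χ)
    {s : DegIdx σ n →₀ ℕ} (hs : s ∈ h.support) {e : DegIdx σ n} (he : e ∈ s.support) :
    n ≤ e.1 (ρ 0) + lam.sortedParts.getD 1 0 := by
  classical
  set Y := lam.youngDiagram with hY
  have hN : ∀ x ∈ Y.cells, x.1 < M := fun x hx => Literature.NumberTheory.DiophantineGeometry.fst_lt_of_mem_youngDiagram lam hlam hx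
  have hd : Y.cells.card = d * n := lam.card_cells_youngDiagram
  have hx : wordOfForm ρ n d h ∈ Literature.NumberTheory.DiophantineGeometry.highestWeightSpace (Literature.NumberTheory.DiophantineGeometry.wordRep k M (d * n)) (Literature.NumberTheory.DiophantineGeometry.ydWeight M Y) := by
    have := wordOfForm_mem_highestWeightSpace hρ hh hhw
    rwa [show (fun i => -χ (ρ i)) = Literature.NumberTheory.DiophantineGeometry.ydWeight M Y from by
      rw [hY, Literature.NumberTheory.DiophantineGeometry.ydWeight_youngDiagram]; funext i; exact hχ i] at this
  have hinv : ∀ τ ∈ blockPerms d n, Literature.NumberTheory.DiophantineGeometry.wordPerm k τ (wordOfForm ρ n d h) = wordOfForm ρ n d h :=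
    fun τ hτ => wordPerm_wordOfForm ρ h hτ
  have h2 : Y.rowLen 1 = lam.sortedParts.getD 1 0 := Literature.NumberTheory.DiophantineGeometry.rowLen_youngDiagram lam 1
  suffices H : n - Y.rowLen 1 ≤ e.1 (ρ 0) by omega
  refine le_apply_of_mem_support_of_polarize hh (ρ 0) (n - Y.rowLen 1) (fun u hu r => ?_) hs he
  -- read `u` as a flat word in the alphabet `Fin M`
  set w : Literature.NumberTheory.DiophantineGeometry.Word M (d * n) := fun q => ρ.symm (u (finProdFinEquiv.symm q).1 (finProdFinEquiv.symm q).2)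
    with hw
  have hwu : wordOfForm ρ n d h w = polarize n d h u := by
    rw [wordOfForm_apply]
    congr 1
    funext r p
    simp only [hw, Equiv.symm_apply_apply, Equiv.apply_symm_apply]
  have hw0 : wordOfForm ρ n d h w ≠ 0 := by rwa [hwu]
  have key := le_blockZeros_add_rowLen_of_mem_highestWeightSpace hN hd hx hinv hw0 r
  have hcount : blockZeros w r = (Finset.univ.filter fun p => u r p = ρ 0).card := by
    rw [blockZeros]
    congr 1
    ext p
    simp only [Finset.mem_filter, Finset.mem_univ, true_and, hw, Equiv.symm_apply_apply]
    rw [Equiv.symm_apply_eq]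
  omega

/-- **BIP Prop. 5.8(2), support form (with Prop. 4.5).** In the situation of
`le_apply_add_of_mem_highestWeightSpace_coordRep`, every monomial `X^s` of `h` contains the
coordinate `X_{x_{ρ 0}^n}` of the `n`-th power of the greatest variable at least `d - (λ₂ + |λ̄|)`
times: `d + λ₁ ≤ s(x_{ρ 0}^n) + d n + λ₂`. BIP, proof of Prop. 5.8(2): "there are at least `d - k`
many letters appearing in singleton columns of `T''` only. In particular, we have `μ = ν♯dm` for
some `ν ⊢ mk`." [cite: BurgisserIkenmeyerPanovaJAMS2019, Prop. 5.8 (2)] -/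
theorem le_apply_single_add_of_mem_highestWeightSpace_coordRep {ρ : Fin M ≃ σ} (hρ : StrictAnti ρ)
    (lam : Nat.Partition (d * n)) (hlam : lam.parts.card ≤ M)
    {h : MvPolynomial (DegIdx σ n) k} (hh : h.IsHomogeneous d) {χ : Literature.NumberTheory.DiophantineGeometry.Weight σ}
    (hχ : ∀ i, -χ (ρ i) = Literature.NumberTheory.DiophantineGeometry.Weight.ofPartition M lam i)
    (hhw : h ∈ Literature.NumberTheory.DiophantineGeometry.highestWeightSpace (coordRep σ k n) χ)
    {s : DegIdx σ n →₀ ℕ} (hs : s ∈ h.support) :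
    d + lam.sortedParts.getD 0 0 ≤
      s ⟨Finsupp.single (ρ 0) n, mem_degMonomials_iff.mpr (Finsupp.degree_single _ _)⟩ +
        d * n + lam.sortedParts.getD 1 0 := by
  classical
  set Y := lam.youngDiagram with hY
  have hN : ∀ x ∈ Y.cells, x.1 < M := fun x hx => Literature.NumberTheory.DiophantineGeometry.fst_lt_of_mem_youngDiagram lam hlam hx
  have hd : Y.cells.card = d * n := lam.card_cells_youngDiagram
  have hx : wordOfForm ρ n d h ∈ Literature.NumberTheory.DiophantineGeometry.highestWeightSpace (Literature.NumberTheory.DiophantineGeometry.wordRep k M (d * n)) (Literature.NumberTheory.DiophantineGeometry.ydWeight M Y) := by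
    have := wordOfForm_mem_highestWeightSpace hρ hh hhw
    rwa [show (fun i => -χ (ρ i)) = Literature.NumberTheory.DiophantineGeometry.ydWeight M Y from by
      rw [hY, Literature.NumberTheory.DiophantineGeometry.ydWeight_youngDiagram]; funext i; exact hχ i] at this
  have h1 : Y.rowLen 0 = lam.sortedParts.getD 0 0 := Literature.NumberTheory.DiophantineGeometry.rowLen_youngDiagram lam 0
  have h2 : Y.rowLen 1 = lam.sortedParts.getD 1 0 := Literature.NumberTheory.DiophantineGeometry.rowLen_youngDiagram lam 1
  suffices H : d + Y.rowLen 0 - d * n - Y.rowLen 1 ≤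
      s ⟨Finsupp.single (ρ 0) n, mem_degMonomials_iff.mpr (Finsupp.degree_single _ _)⟩ by omega
  refine le_apply_single_of_mem_support_of_polarize hh (ρ 0) _ (fun u hu => ?_) hs
  set w : Literature.NumberTheory.DiophantineGeometry.Word M (d * n) := fun q => ρ.symm (u (finProdFinEquiv.symm q).1 (finProdFinEquiv.symm q).2)
    with hw
  have hwu : wordOfForm ρ n d h w = polarize n d h u := by
    rw [wordOfForm_apply]
    congr 1
    funext r p
    simp only [hw, Equiv.symm_apply_apply, Equiv.apply_symm_apply]
  have hw0 : wordOfForm ρ n d h w ≠ 0 := by rwa [hwu]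
  have key := le_zeroBlocks_add_of_mem_highestWeightSpace hN hd hx hw0
  have hcount : zeroBlocks w = (Finset.univ.filter fun r => u r = fun _ => ρ 0).card := by
    rw [zeroBlocks]
    congr 1
    ext r
    simp only [Finset.mem_filter, Finset.mem_univ, true_and, hw, Equiv.symm_apply_apply]
    rw [_root_.funext_iff]
    refine forall_congr' fun p => ?_
    rw [Equiv.symm_apply_eq]
  rw [hd] at key
  omega

/-- **Weights transfer back along the dual inner lifting** (converse of BIP Lemma 5.3 "The inner
lifting `κ` maps highest weight vectors of weight `μ ⊢ dm` to highest weight vectors of weight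
`μ♯dn`", by injectivity): if `innerLift F` (`F` a form of degree `D`, `m ≤ n`, `iₘ` the greatest
index) is a highest-weight vector of weight `χ`, then `F` is one of weight
`χ + (n-m)D ε_{iₘ}`. [cite: BurgisserIkenmeyerPanovaJAMS2019, Lemma 5.3] -/
theorem mem_highestWeightSpace_of_innerLift_mem (iₘ : σ) (hiₘ : ∀ j, j ≤ iₘ) {m' n' : ℕ}
    (hmn : m' ≤ n') {F : MvPolynomial (DegIdx σ m') k} {D : ℕ} (hF : F.IsHomogeneous D)
    {χ : Literature.NumberTheory.DiophantineGeometry.Weight σ} (hχ : innerLift iₘ m' n' F ∈ Literature.NumberTheory.DiophantineGeometry.highestWeightSpace (coordRep σ k n') χ) :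
    F ∈ Literature.NumberTheory.DiophantineGeometry.highestWeightSpace (coordRep σ k m') (χ + Pi.single iₘ ((((n' - m') * D : ℕ)) : ℤ)) := by
  intro b hb
  have h1 := hχ b hb
  rw [coordRep_apply, coordSubst_innerLift iₘ hiₘ hmn hb hF] at h1
  have h1' : innerLift iₘ m' n' ((((b⁻¹ : GL σ k) : Matrix σ σ k) iₘ iₘ ^ (n' - m')) ^ D •
      coordSubst m' b F) = innerLift iₘ m' n' (Literature.NumberTheory.DiophantineGeometry.weightChar χ b • F) := by
    rw [map_smul, map_smul]; exact h1
  have h2 := innerLift_injective iₘ hmn h1'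
  -- solve for `coordSubst m' b F`
  set c : k := (((b⁻¹ : GL σ k) : Matrix σ σ k) iₘ iₘ ^ (n' - m')) ^ D with hc
  have hc0 : c ≠ 0 := by
    rw [hc]
    exact pow_ne_zero _ (pow_ne_zero _ (Literature.NumberTheory.DiophantineGeometry.diag_ne_zero_of_isUpperTriangular
      ((Literature.NumberTheory.DiophantineGeometry.borelSubgroup σ k).inv_mem hb) iₘ))
  have h3 := congrArg (fun P => c⁻¹ • P) h2
  simp only [smul_smul, inv_mul_cancel₀ hc0, one_smul] at h3
  rw [coordRep_apply, h3]
  congr 1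
  rw [Literature.NumberTheory.DiophantineGeometry.weightChar_add _ _ hb, Literature.NumberTheory.DiophantineGeometry.weightChar_single, hc, inv_apply_diag_of_isUpperTriangular' hb,
    ← pow_mul, inv_pow, inv_inv, mul_comm, zpow_natCast]

end Main

end Literature.Computability.AlgebraicComplexity


/-! ### 8. Tableau vectors `v_T` in the word model, the contraction rule and a positivity criterion -/

namespace Literature.Computability.AlgebraicComplexity


section StdFilling
open Literature.NumberTheory.DiophantineGeometry (StdFilling)
open Literature.NumberTheory.DiophantineGeometry.StdFilling

variable {k : Type*} [Field k] {N d : ℕ} {Y : YoungDiagram}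

/-- For `σ ∈ C_T`: `u = w_T ∘ σ⁻¹` iff `σ⁻¹` sends every entry `p` to the entry of `T` in the
cell `(u p, col p)` (row prescribed by the letter, same column). [folklore] -/
theorem _root_.Literature.NumberTheory.DiophantineGeometry.StdFilling.eq_rowWord_comp_iff (hN : ∀ x ∈ Y.cells, x.1 < N) (T : StdFilling d Y) {σ : Equiv.Perm (Fin d)}
    (hσ : σ ∈ T.colStab) (u : Literature.NumberTheory.DiophantineGeometry.Word N d) :
    u = T.rowWord hN ∘ ⇑σ⁻¹ ↔ ∀ p, T.1 (σ⁻¹ p) = ((u p : ℕ), (T.1 p).2) := by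
  constructor
  · intro h p
    have hp := congrFun h p
    refine Prod.ext ?_ ?_
    · rw [hp]; rfl
    · have := StdFilling.mem_colStab.1 (StdFilling.inv_mem_colStab hσ) p
      exact this
  · intro h
    funext p
    apply Fin.ext
    change (u p : ℕ) = (T.1 (σ⁻¹ p)).1
    rw [h p]

/-- **The value of a polytabloid at a word is a column sign** (BIP (4.2)–(4.3):
`⟨v_λ, X_{s(1)} ⊗ ⋯ ⊗ X_{s(dn)}⟩ = val_{ϑ₀}(s) = ∏_{columns c} sgn((s ∘ ϑ₀)|_c)`). If some
`σ ∈ C_T` satisfies `T(σ⁻¹ p) = (u p, col p)` for all entries `p` — in every column of `T` the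
letters of `u` are the arrangement `σ` of the row indices — then `e_T(u) = sgn σ` (and `σ` is
unique). [cite: BurgisserIkenmeyerPanovaJAMS2019, Thm. 4.7 (proof, (4.3))] -/
theorem _root_.Literature.NumberTheory.DiophantineGeometry.StdFilling.polytabloid_apply_of_forall_eq (hN : ∀ x ∈ Y.cells, x.1 < N) (T : StdFilling d Y)
    {σ : Equiv.Perm (Fin d)} (hσ : σ ∈ T.colStab) {u : Literature.NumberTheory.DiophantineGeometry.Word N d}
    (hu : ∀ p, T.1 (σ⁻¹ p) = ((u p : ℕ), (T.1 p).2)) :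
    T.polytabloid k hN u = ((Equiv.Perm.sign σ : ℤ) : k) := by
  classical
  rw [StdFilling.polytabloid_apply, Finset.sum_eq_single_of_mem σ hσ]
  · rw [if_pos ((T.eq_rowWord_comp_iff hN hσ u).mpr hu)]
  · intro σ' hσ' hne
    rw [if_neg]
    intro h'
    apply hne
    -- uniqueness: `σ'⁻¹ = σ⁻¹` since `T` is injective
    have h1 := (T.eq_rowWord_comp_iff hN hσ' u).mp h'
    have : σ'⁻¹ = σ⁻¹ := Equiv.ext fun p => T.injective ((h1 p).trans (hu p).symm)
    exact inv_injective this

/-- If no `σ ∈ C_T` arranges the letters of `u` columnwise into the row indices (some column of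
`u` is not a permutation of `0, …, h-1`), then `e_T(u) = 0` — BIP: "`sgn(j) := 0`" if the list is
not a permutation. [cite: BurgisserIkenmeyerPanovaJAMS2019, §4(b) (4.2)] -/
theorem _root_.Literature.NumberTheory.DiophantineGeometry.StdFilling.polytabloid_apply_eq_zero_of_forall_ne (hN : ∀ x ∈ Y.cells, x.1 < N) (T : StdFilling d Y)
    {u : Literature.NumberTheory.DiophantineGeometry.Word N d} (hu : ∀ σ ∈ T.colStab, ∃ p, T.1 (σ⁻¹ p) ≠ ((u p : ℕ), (T.1 p).2)) :
    T.polytabloid k hN u = 0 := by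
  classical
  rw [StdFilling.polytabloid_apply]
  refine Finset.sum_eq_zero fun σ hσ => ?_
  rw [if_neg]
  intro h
  obtain ⟨p, hp⟩ := hu σ hσ
  exact hp ((T.eq_rowWord_comp_iff hN hσ u).mp h p)

end StdFilling



section TabVector

variable (k : Type*) [Field k] {N D m : ℕ} {Y : YoungDiagram}

/-- `τ ∘ Σ = Σ` for `τ` in the wreath product (left invariance). [cite: BurgisserIkenmeyerPanovaJAMS2019, §4 (4.1)] -/
theorem wordPerm_blockSymmetrizer {τ : Equiv.Perm (Fin (D * m))} (hτ : τ ∈ blockPerms D m)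
    (x : Literature.NumberTheory.DiophantineGeometry.Word N (D * m) → k) :
    Literature.NumberTheory.DiophantineGeometry.wordPerm k τ (blockSymmetrizer k D m x) = blockSymmetrizer k D m x := by
  rw [blockSymmetrizer, LinearMap.sum_apply, map_sum]
  simp_rw [← LinearMap.comp_apply (f := Literature.NumberTheory.DiophantineGeometry.wordPerm k τ), ← Literature.NumberTheory.DiophantineGeometry.wordPerm_mul]
  refine Finset.sum_bij' (fun τ' _ => τ * τ') (fun τ' _ => τ⁻¹ * τ') ?_ ?_ ?_ ?_ ?_
  · intro τ' hτ'
    exact mem_blockPermsFinset.mpr ((blockPerms D m).mul_mem hτ (mem_blockPermsFinset.mp hτ'))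
  · intro τ' hτ'
    exact mem_blockPermsFinset.mpr
      ((blockPerms D m).mul_mem ((blockPerms D m).inv_mem hτ) (mem_blockPermsFinset.mp hτ'))
  · intro τ' _; simp
  · intro τ' _; simp
  · intro τ' _; rfl

variable {k}

/-- The wreath symmetriser preserves highest-weight spaces (it is a sum of position
permutations, which commute with `GL`). [cite: BurgisserIkenmeyerPanovaJAMS2019, §4(a) ("`v_T` is a highest weight vector")] -/
theorem blockSymmetrizer_mem_highestWeightSpace {χ : Literature.NumberTheory.DiophantineGeometry.Weight (Fin N)} {x : Literature.NumberTheory.DiophantineGeometry.Word N (D * m) → k}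
    (hx : x ∈ Literature.NumberTheory.DiophantineGeometry.highestWeightSpace (Literature.NumberTheory.DiophantineGeometry.wordRep k N (D * m)) χ) :
    blockSymmetrizer k D m x ∈ Literature.NumberTheory.DiophantineGeometry.highestWeightSpace (Literature.NumberTheory.DiophantineGeometry.wordRep k N (D * m)) χ := by
  rw [blockSymmetrizer, LinearMap.sum_apply]
  exact Submodule.sum_mem _ fun τ _ => Literature.NumberTheory.DiophantineGeometry.wordPerm_mem_highestWeightSpace τ hx

variable (k)

/-- **BIP's tableau vectors `v_T` in the word model** (Def. 4.2: "`v_T := Σ_{d,n} π v_λ` where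
`π ∈ S_{dn}` is such that `T = T_λ(π)`"), unnormalised: the wreath symmetrisation of the position
permutation `π` applied to the polytabloid `e_{T₀}` of a standard tableau `T₀` (the tableau with
content being: cell `c` carries the letter "block of `π⁻¹(T₀⁻¹ c)`"). [cite: BurgisserIkenmeyerPanovaJAMS2019, Def. 4.2] -/
noncomputable def tabVector (hN : ∀ x ∈ Y.cells, x.1 < N) (T₀ : Literature.NumberTheory.DiophantineGeometry.StdFilling (D * m) Y)
    (π : Equiv.Perm (Fin (D * m))) : Literature.NumberTheory.DiophantineGeometry.Word N (D * m) → k :=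
  blockSymmetrizer k D m (Literature.NumberTheory.DiophantineGeometry.wordPerm k π (T₀.polytabloid k hN))

variable {k}

/-- `v_T` is a highest-weight vector of weight `λ` (BIP: "By Proposition 3.3, `v_T` is a highest
weight vector in `Sym^d Sym^n V` of weight `λ`"). [cite: BurgisserIkenmeyerPanovaJAMS2019, §4(a)] -/
theorem tabVector_mem_highestWeightSpace [CharZero k] (hN : ∀ x ∈ Y.cells, x.1 < N)
    (T₀ : Literature.NumberTheory.DiophantineGeometry.StdFilling (D * m) Y) (hd : Y.cells.card = D * m) (π : Equiv.Perm (Fin (D * m))) :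
    tabVector k hN T₀ π ∈ Literature.NumberTheory.DiophantineGeometry.highestWeightSpace (Literature.NumberTheory.DiophantineGeometry.wordRep k N (D * m)) (Literature.NumberTheory.DiophantineGeometry.ydWeight N Y) :=
  blockSymmetrizer_mem_highestWeightSpace (Literature.NumberTheory.DiophantineGeometry.wordPerm_mem_highestWeightSpace π (T₀.polytabloid_mem hN hd))

/-- `v_T` is `S_D ≀ S_m`-invariant (it lies in the plethysm, (4.1)). [cite: BurgisserIkenmeyerPanovaJAMS2019, §4 (4.1)] -/
theorem wordPerm_tabVector (hN : ∀ x ∈ Y.cells, x.1 < N) (T₀ : Literature.NumberTheory.DiophantineGeometry.StdFilling (D * m) Y)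
    (π : Equiv.Perm (Fin (D * m))) {τ : Equiv.Perm (Fin (D * m))} (hτ : τ ∈ blockPerms D m) :
    Literature.NumberTheory.DiophantineGeometry.wordPerm k τ (tabVector k hN T₀ π) = tabVector k hN T₀ π :=
  wordPerm_blockSymmetrizer k hτ _

/-- **The contraction rule, BIP Thm. 4.7, in the word model**: `v_T(s) = ∑_{τ ∈ S_D ≀ S_m}
e_{T₀}(s ∘ τ ∘ π)` ("`⟨v_T, X_s⟩ = (1/(d! n!^d)) ∑_ϑ val_ϑ(s)`, the sum over all bijections
`ϑ : λ → [dn]` respecting `T`"; the respecting bijections are `ϑ = σ ∘ π ∘ ϑ₀`, `σ` in the wreath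
product, and `val` is the column sign `polytabloid_apply_of_forall_eq`). [cite: BurgisserIkenmeyerPanovaJAMS2019, Thm. 4.7] -/
theorem tabVector_apply (hN : ∀ x ∈ Y.cells, x.1 < N) (T₀ : Literature.NumberTheory.DiophantineGeometry.StdFilling (D * m) Y)
    (π : Equiv.Perm (Fin (D * m))) (s : Literature.NumberTheory.DiophantineGeometry.Word N (D * m)) :
    tabVector k hN T₀ π s = ∑ τ ∈ blockPermsFinset D m, T₀.polytabloid k hN (s ∘ ⇑τ ∘ ⇑π) := by
  rw [tabVector, blockSymmetrizer_apply]
  rfl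

/-- **Positivity criterion (the mechanism of BIP Claim 7.1 and Props. 7.2, 7.3).** Evaluate
`v_T` at the "row tensor" `s = w_{T₀} ∘ π⁻¹` (BIP §7: `Φ = ⊗_u m_u`, `m_u = ⊗_{boxes of u} X_{row}`).
If for every block permutation `τ` and every `σ ∈ C_{T₀}` with `T₀(σ⁻¹ p) = (s(τ(π p)), col p)`
for all `p` one has `σ = 1` — every respecting bijection with nonzero value keeps every box in
its row — then `v_T(s) ≠ 0`: every nonzero summand of Thm. 4.7 equals `+1` and `τ = 1`
contributes (BIP: "all nonzero summands … have the value `1` and there exists a nonzero summand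
that is trivial to construct"). [cite: BurgisserIkenmeyerPanovaJAMS2019, Claim 7.1 and Prop. 7.2 (proof)] -/
theorem tabVector_apply_ne_zero [CharZero k] (hN : ∀ x ∈ Y.cells, x.1 < N) (T₀ : Literature.NumberTheory.DiophantineGeometry.StdFilling (D * m) Y)
    (π : Equiv.Perm (Fin (D * m)))
    (hstar : ∀ τ ∈ blockPerms D m, ∀ σ ∈ T₀.colStab,
      (∀ p, T₀.1 (σ⁻¹ p) = (((T₀.rowWord hN ∘ ⇑π⁻¹) (τ (π p)) : ℕ), (T₀.1 p).2)) → σ = 1) :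
    tabVector k hN T₀ π (T₀.rowWord hN ∘ ⇑π⁻¹) ≠ 0 := by
  classical
  set s : Literature.NumberTheory.DiophantineGeometry.Word N (D * m) := T₀.rowWord hN ∘ ⇑π⁻¹ with hs
  -- every summand is `0` or `1`
  have hterm : ∀ τ ∈ blockPermsFinset D m,
      T₀.polytabloid k hN (s ∘ ⇑τ ∘ ⇑π) = if (∃ σ ∈ T₀.colStab,
        ∀ p, T₀.1 (σ⁻¹ p) = (((s ∘ ⇑τ ∘ ⇑π) p : ℕ), (T₀.1 p).2)) then 1 else 0 := by
    intro τ hτ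
    split_ifs with h
    · obtain ⟨σ, hσ, hσp⟩ := h
      have hσ1 : σ = 1 := hstar τ (mem_blockPermsFinset.mp hτ) σ hσ hσp
      rw [T₀.polytabloid_apply_of_forall_eq hN hσ hσp, hσ1, Equiv.Perm.sign_one]
      simp
    · refine T₀.polytabloid_apply_eq_zero_of_forall_ne hN fun σ hσ => ?_
      by_contra hall
      push Not at hall
      exact h ⟨σ, hσ, hall⟩
  rw [tabVector_apply, Finset.sum_congr rfl hterm, Finset.sum_boole, Nat.cast_ne_zero, ← Nat.pos_iff_ne_zero,
    Finset.card_pos]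
  refine ⟨1, ?_⟩
  simp only [Finset.mem_filter]
  refine ⟨one_mem_blockPermsFinset, 1, T₀.one_mem_colStab, fun p => ?_⟩
  simp [hs]

end TabVector


end Literature.Computability.AlgebraicComplexity
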